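import Literature.NumberTheory.LFunctions.MoebiusWalshTypeIICountingHigh
import Literature.NumberTheory.LFunctions.MoebiusWalshTypeIIHigh
import Literature.NumberTheory.LFunctions.MoebiusWalshTypeIIZero
import Literature.NumberTheory.LFunctions.LiouvilleWalshTypeIIZeroClean
import Literature.NumberTheory.LFunctions.MoebiusWalshCounting
import Literature.NumberTheory.Sieve.VaughanMeanValueDecomposition
import Mathlib.Analysis.SpecialFunctions.Pow.Real
import HarnessLib

/-!
# Bourgain 2013, §2: the type-II box estimate for the SHIFTED digit windows (`K ≥ μ - ρ`) in the
# three-savings form `2^{-cρ} + 2^{Cρ - ci} + 2^{Cρ - c|T ∩ [K,K+i)|}` — proved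

Topic `Literature/NumberTheory/LFunctions`, proofs companion of `MoebiusWalshCircuits.lean`
(named fact `bourgain_liouville_walsh_uniform`: J. Bourgain, *Möbius–Walsh correlation bounds and
an estimate of Mauduit and Rivat*, J. Anal. Math. **119** (2013) 147–163 = arXiv:1109.2784
[Bourgain2013MoebiusWalsh], Theorem 1, remark on `λ`). Everything here is PROVED (theorems only; no
definition, no named fact).

This is the `K > 0` half of the per-box type-II hypothesis `hII` of the `λ`-synthesis
`LiouvilleWalsh.bourgain_liouville_walsh_uniform_of_typeII` (`LiouvilleWalshAssembly.lean`); the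
`K = 0` half is `LiouvilleWalsh.typeII_clean_zero` (`LiouvilleWalshTypeIIZeroClean.lean`). It is
Bourgain's §2 for the shifted windows `[K, K + μ + ρ']`, `μ - ρ ≤ K ≤ ν - ρ` ((2.1)–(2.12),
(2.23)–(2.29)), assembled from the tree's layers in the order of the paper:

* **Step 1, (2.1)–(2.2)** `sq_sum_abs_le_vdC`: Cauchy–Schwarz over the short variable and the
  bilinear van der Corput inequality with lags `d·2^K`, `d < L = 2^ρ` (tree: `MoebiusWalsh.vdC_bilinear`);
* **Step 2, digit truncation** ("cf. Lemma 5 in [M-R]") `abs_sum_mul_le_window_add_carry`,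
  `sum_card_carry_le`: away from the carry exceptions the differenced product only sees the digits
  in `[K, K + i + 2ρ + 3)` (tree: `MoebiusWalshTypeII.natWalsh_mul_natWalsh_add_eq_window`,
  `card_filter_carry_le`); with slack `t = ρ + 2` the exceptions are EMPTY when `K ≥ j - 2ρ` (the
  window reaches the top digit of the products) and number `≤ 3·2^{i+j}/2^ρ` otherwise;
* **Step 3, (2.3)–(2.4), Lemma 5** `sum_abs_le_localised_add_error`: `w_{T'} ↦ W` with
  `K₁ = 2^{2ρ}` (tree: `MoebiusWalsh.localisedWalshRe`, `sum_norm_sq_localisedWalsh_sub_walshNat_le`,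
  `norm_localisedWalsh_le`), the replacement error through the multiplicities `≤ τ(x)` of the
  products `a(b+s)` and `∑_{x ≤ Y} τ(x)² ≤ Y(1 + log Y)³` (tree: `Sieve.Vaughan.sum_sq_card_divisors_le`;
  `sum_sum_shift_le_sqrt`, `sum_Ioc_sq_sub_le`);
* **Step 4, (2.11)–(2.14), (2.23)–(2.28)** `sum_abs_localised_le_count`: the Fourier expansion of
  the localised product (tree: `MoebiusWalsh.abs_sum_Ico_localisedWalshRe_mul_le`), the diagonal by
  the sup bound (tree: `sum_Ioo_mul_geomBound_le_sup`, Lemma 2), and the off-diagonal by the HIGH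
  pair count `MoebiusWalsh.typeII_count_high` (tree) fed with the Fourier data of `W`: total mass
  `4(K+2)2^{κσ}` ((1.11), `sum_Ioo_norm_localisedCoeff_le`), sup `2·2^{-c₂|T'|}`
  (`norm_localisedCoeff_le_sup`) and windows `≤ 16 J^κ` up to `J ≤ 4·2^{K+σ}`
  (`sum_Ico_norm_localisedCoeff_le_sixteen`, Lemma 6 on four sub-windows);
* **Step 5** `count_high_algebra` (pure real arithmetic): with `2^σ = 2^i 2^{2ρ+3}`,
  `F = 2^{2ρ+1}2^σ`, `2^i ≤ 2^K 2^ρ ≤ … ≤ 2^j`, `D₀ ≥ 1`, the diagonal and `(K+σ)(T_A + T_{B1} + T_{B2})`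
  are `≤ 2^i 2^j (K+σ+2)³ λ 2^{6ρ+25} (2^{-(1-2κ)i} + D₀^{-(1-2κ)} + η D₀²)` — Bourgain's three savings
  `M^{-c}`, `L^{-C(1-2κ)}` (`D₀ = L^C`), `‖ŵ‖_∞ L^{O(C)}` of (2.24)–(2.27);
* **Steps 6–7** `sum_localised_le`, `sq_sum_abs_le_high` (the squared estimate with an explicit
  `Φ`), and **`typeII_clean_high`**: there are `c > 0`, `C ≥ 1`
  (`c = min(1/4, (1-2κ)/2, c₂/2)`, `C = ⌈7/(1-2κ)⌉ + 40`, with `D₀ = 2^{⌈7/(1-2κ)⌉ρ}`) such that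
  `∑_{a ∈ D_i} |∑_{b ∈ D_j} β(b) w_T(ab)| ≤ (i+j+2)^C 2^{i+j} (2^{-cρ} + 2^{Cρ-ci} + 2^{Cρ-c|T ∩ [K,K+i)|})`
  whenever `i ≤ j`, `1 ≤ ρ`, `i ≤ K + ρ`, `4ρ < K`, `K + ρ ≤ j`, `|β| ≤ 1`.

Parallel files of other seats (`MoebiusWalshTypeIIHighWalsh.lean`, `MoebiusWalshTypeIICountingHighWalsh.lean`,
`MoebiusWalshResonanceWindow.lean`, landed while this file was written) treat the same step of the
paper in their own normalisations towards `bourgain_moebius_walsh_uniform`; nothing from them is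
restated here, and the shared inputs (`typeII_count_high`, the localisation, the pair expansion)
are IMPORTED; the elementary helpers `factorization_two_lt_of_mem_Ico`, `sqrt_two_rpow`,
`sqrt_add_le_sqrt_add_sqrt''` come from `LiouvilleWalshTypeIIZeroClean.lean`.

## References

* J. Bourgain, J. Anal. Math. 119 (2013) 147–163; arXiv:1109.2784, §2 (2.1)–(2.12), (2.23)–(2.29);
  §1 Lemma 5, Lemma 6. [Bourgain2013MoebiusWalsh]
* C. Mauduit, J. Rivat, Ann. of Math. 171 (2010) 1591–1646, Lemmes 4–5 (differencing, carries),
  cited through Bourgain.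
-/

noncomputable section

open Finset Real

namespace Literature.NumberTheory.LFunctions.LiouvilleWalsh

open Literature.NumberTheory.LFunctions.MoebiusWalshVaughan (natWalsh dyBlock mem_dyBlock boxSum
  abs_natWalsh)
open Literature.NumberTheory.LFunctions.MoebiusWalsh (walshSupExponent walshL1Exponent
  walshSupExponent_pos walshL1Exponent_pos walshL1Exponent_lt_half vdC_bilinear walshNat
  localisedWalsh localisedWalshRe localisedCoeff)
open Literature.NumberTheory.LFunctions.MoebiusWalshTypeII (card_dyBlock dyBlock_eq_Ico_add
  natWalsh_mul_self natWalsh_mul_natWalsh_add_eq_window card_filter_carry_le)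
open Literature.NumberTheory.Sieve.Vinogradov (geomBound geomBound_nonneg)

/-! ### Step 1: Cauchy–Schwarz and van der Corput with lags `d·2^K` -/

/-- **(2.1)–(2.2) for a dyadic box with lags `d 2^K`**: for `|β| ≤ 1`, `(L-1)2^K ≤ 2^j`, `1 ≤ L`,
`(∑_{a ∈ D_i} |∑_{b ∈ D_j} β(b) w_T(ab)|)² ≤ (4·2^i 2^j / L)(2^i 2^j + ∑_{1 ≤ d < L} ∑_{b ∈ D_j} |∑_{a ∈ D_i} w_T(a(b + d2^K)) w_T(ab)|)`.
[cite: Bourgain2013MoebiusWalsh, §2 (2.1)–(2.2)] -/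
theorem sq_sum_abs_le_vdC (T : Finset ℕ) (i j K : ℕ) {L : ℕ} (hL : 1 ≤ L) (hLK : (L - 1) * 2 ^ K ≤ 2 ^ j)
    {β : ℕ → ℝ} (hβ : ∀ b, |β b| ≤ 1) :
    (∑ a ∈ dyBlock i, |∑ b ∈ dyBlock j, β b * natWalsh T (a * b)|) ^ 2 ≤
      (4 * (2 : ℝ) ^ i * 2 ^ j / L) *
        ((2 : ℝ) ^ i * 2 ^ j + ∑ d ∈ Ico 1 L, ∑ b ∈ dyBlock j,
          |∑ a ∈ dyBlock i, natWalsh T (a * (b + d * 2 ^ K)) * natWalsh T (a * b)|) := by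
  classical
  set M : ℕ := 2 ^ i with hM
  set N : ℕ := 2 ^ j with hN
  -- Cauchy–Schwarz over `a`
  have hCS : (∑ a ∈ dyBlock i, |∑ b ∈ dyBlock j, β b * natWalsh T (a * b)|) ^ 2 ≤
      (2 : ℝ) ^ i * ∑ a ∈ dyBlock i, (∑ b ∈ dyBlock j, β b * natWalsh T (a * b)) ^ 2 := by
    have h := Finset.sum_mul_sq_le_sq_mul_sq (dyBlock i)
      (fun a => |∑ b ∈ dyBlock j, β b * natWalsh T (a * b)|) (fun _ => (1 : ℝ))
    have e1 : ∑ a ∈ dyBlock i, |∑ b ∈ dyBlock j, β b * natWalsh T (a * b)| * 1 =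
        ∑ a ∈ dyBlock i, |∑ b ∈ dyBlock j, β b * natWalsh T (a * b)| := by simp
    have e2 : ∑ _a ∈ dyBlock i, (1 : ℝ) ^ 2 = 2 ^ i := by
      rw [Finset.sum_const, card_dyBlock]; simp
    have e3 : ∑ a ∈ dyBlock i, |∑ b ∈ dyBlock j, β b * natWalsh T (a * b)| ^ 2 =
        ∑ a ∈ dyBlock i, (∑ b ∈ dyBlock j, β b * natWalsh T (a * b)) ^ 2 := by
      refine Finset.sum_congr rfl fun a _ => sq_abs _
    rw [e1, e2, e3] at h
    linarith
  -- van der Corput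
  have hvdC := vdC_bilinear (fun a b => natWalsh T (a * b)) (A := dyBlock i) (B₀ := N) (N := N)
    (R := 2 ^ K) (H := L) (by omega) (by rw [hN]; exact hLK) hβ
  rw [← dyBlock_eq_Ico_add] at hvdC
  -- the `d = 0` term and dropping the indicator
  have hsplit : ∑ d ∈ range L, ∑ b ∈ dyBlock j,
      (if b + d * 2 ^ K < N + N then |∑ a ∈ dyBlock i, natWalsh T (a * (b + d * 2 ^ K)) * natWalsh T (a * b)|
        else 0) ≤
      (2 : ℝ) ^ i * 2 ^ j + ∑ d ∈ Ico 1 L, ∑ b ∈ dyBlock j,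
        |∑ a ∈ dyBlock i, natWalsh T (a * (b + d * 2 ^ K)) * natWalsh T (a * b)| := by
    have hrange : range L = insert 0 (Ico 1 L) := by
      ext d; simp only [Finset.mem_range, Finset.mem_insert, Finset.mem_Ico]; omega
    rw [hrange, Finset.sum_insert (by simp)]
    refine add_le_add ?_ (Finset.sum_le_sum fun d _ => Finset.sum_le_sum fun b _ => ?_)
    · simp only [zero_mul, add_zero]
      calc ∑ b ∈ dyBlock j, (if b < N + N then |∑ a ∈ dyBlock i, natWalsh T (a * b) * natWalsh T (a * b)| else 0)
          ≤ ∑ _b ∈ dyBlock j, ((2 ^ i : ℕ) : ℝ) := by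
            refine Finset.sum_le_sum fun b _ => ?_
            split_ifs
            · rw [Finset.sum_congr rfl fun a _ => natWalsh_mul_self T (a * b), Finset.sum_const,
                card_dyBlock, nsmul_eq_mul, mul_one, abs_of_nonneg (by positivity)]
            · positivity
        _ = (2 : ℝ) ^ i * 2 ^ j := by rw [Finset.sum_const, card_dyBlock, nsmul_eq_mul]; push_cast; ring
    · split_ifs
      · exact le_rfl
      · positivity
  -- the prefactor
  have hpre : 2 * ((N : ℝ) + (L - 1 : ℕ) * (2 ^ K : ℕ)) / L ≤ 4 * (2 : ℝ) ^ j / L := by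
    have hL0 : (0 : ℝ) < L := by exact_mod_cast hL
    rw [div_le_div_iff_of_pos_right hL0]
    have : (((L - 1) * 2 ^ K : ℕ) : ℝ) ≤ ((2 ^ j : ℕ) : ℝ) := by exact_mod_cast hLK
    push_cast at this ⊢
    rw [hN]; push_cast
    linarith
  have hsum0 : 0 ≤ ∑ d ∈ range L, ∑ b ∈ dyBlock j,
      (if b + d * 2 ^ K < N + N then |∑ a ∈ dyBlock i, natWalsh T (a * (b + d * 2 ^ K)) * natWalsh T (a * b)|
        else 0) := by
    refine Finset.sum_nonneg fun d _ => Finset.sum_nonneg fun b _ => ?_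
    split_ifs <;> positivity
  calc (∑ a ∈ dyBlock i, |∑ b ∈ dyBlock j, β b * natWalsh T (a * b)|) ^ 2
      ≤ (2 : ℝ) ^ i * ∑ a ∈ dyBlock i, (∑ b ∈ dyBlock j, β b * natWalsh T (a * b)) ^ 2 := hCS
    _ ≤ (2 : ℝ) ^ i * ((2 * ((N : ℝ) + (L - 1 : ℕ) * (2 ^ K : ℕ)) / L) *
        ∑ d ∈ range L, ∑ b ∈ dyBlock j,
          (if b + d * 2 ^ K < N + N then
            |∑ a ∈ dyBlock i, natWalsh T (a * (b + d * 2 ^ K)) * natWalsh T (a * b)| else 0)) :=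
        mul_le_mul_of_nonneg_left hvdC (by positivity)
    _ ≤ (2 : ℝ) ^ i * ((4 * (2 : ℝ) ^ j / L) *
        ((2 : ℝ) ^ i * 2 ^ j + ∑ d ∈ Ico 1 L, ∑ b ∈ dyBlock j,
          |∑ a ∈ dyBlock i, natWalsh T (a * (b + d * 2 ^ K)) * natWalsh T (a * b)|)) := by
        refine mul_le_mul_of_nonneg_left ?_ (by positivity)
        exact mul_le_mul hpre hsplit hsum0 (by positivity)
    _ = _ := by ring

/-! ### Step 3 (error term): products `a(b+s)` hit each `x` at most `τ(x)` times -/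

open scoped ArithmeticFunction.sigma in
/-- **Divisor-bounded multiplicity and Cauchy–Schwarz**: for `g ≥ 0` and a shift `s` with
`2^{j+1} + s ≤ 2^{j+2}`, `∑_{a ∈ D_i} ∑_{b ∈ D_j} g(a(b+s)) ≤ √(Y(1+log Y)³) · √(∑_{x ∈ (0,Y]} g(x)²)`,
`Y = 2^{i+j+3}` (each `x` is hit by at most `τ(x)` pairs, and `∑_{x ≤ Y} τ(x)² ≤ Y(1 + log Y)³`, tree).
[cite: Bourgain2013MoebiusWalsh, §2 (2.4)] -/
theorem sum_sum_shift_le_sqrt (i j s : ℕ) (hs : s ≤ 2 ^ (j + 1)) {g : ℕ → ℝ} (hg : ∀ x, 0 ≤ g x) :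
    ∑ a ∈ dyBlock i, ∑ b ∈ dyBlock j, g (a * (b + s)) ≤
      Real.sqrt ((2 ^ (i + j + 3) : ℕ) * (1 + Real.log ((2 ^ (i + j + 3) : ℕ))) ^ 3) *
        Real.sqrt (∑ x ∈ Ioc 0 (2 ^ (i + j + 3)), g x ^ 2) := by
  classical
  set Y : ℕ := 2 ^ (i + j + 3) with hY
  set P : Finset (ℕ × ℕ) := dyBlock i ×ˢ dyBlock j with hP
  set f : ℕ × ℕ → ℕ := fun p => p.1 * (p.2 + s) with hf
  -- rewrite as a sum over pairs, then fiberwise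
  have h1 : ∑ a ∈ dyBlock i, ∑ b ∈ dyBlock j, g (a * (b + s)) = ∑ p ∈ P, g (f p) := by
    rw [hP, Finset.sum_product]
  have h2 : ∑ p ∈ P, g (f p) = ∑ x ∈ P.image f, ((P.filter fun p => f p = x).card : ℝ) * g x := by
    rw [Finset.sum_comp]
    refine Finset.sum_congr rfl fun x _ => ?_
    rw [nsmul_eq_mul]
  -- the fibres are at most `τ(x)`
  have hfib : ∀ x ∈ P.image f, ((P.filter fun p => f p = x).card : ℝ) ≤ ((Nat.divisors x).card : ℝ) := by
    intro x hx
    have hx0 : x ≠ 0 := by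
      rw [Finset.mem_image] at hx
      obtain ⟨p, hp, rfl⟩ := hx
      rw [hP, Finset.mem_product, mem_dyBlock, mem_dyBlock] at hp
      have h1 : 0 < p.1 := lt_of_lt_of_le (Nat.two_pow_pos i) hp.1.1
      have h2 : 0 < p.2 + s := by have := Nat.two_pow_pos j; omega
      exact Nat.mul_ne_zero h1.ne' h2.ne'
    norm_cast
    refine Finset.card_le_card_of_injOn (fun p => p.1) (fun p hp => ?_) ?_
    · rw [Finset.mem_coe, Finset.mem_filter] at hp
      rw [Finset.mem_coe, Nat.mem_divisors]
      exact ⟨⟨p.2 + s, hp.2.symm⟩, hx0⟩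
    · intro p hp p' hp' heq
      rw [Finset.mem_coe, Finset.mem_filter, hP, Finset.mem_product, mem_dyBlock] at hp hp'
      have ha : 0 < p.1 := lt_of_lt_of_le (Nat.two_pow_pos i) hp.1.1.1
      have he : f p = f p' := hp.2.trans hp'.2.symm
      simp only [hf] at he
      simp only at heq
      rw [← heq] at he
      have := Nat.eq_of_mul_eq_mul_left ha he
      exact Prod.ext heq (by omega)
  -- the image lies in `(0, Y]`
  have himg : P.image f ⊆ Ioc 0 Y := by
    intro x hx
    rw [Finset.mem_image] at hx
    obtain ⟨p, hp, rfl⟩ := hx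
    rw [hP, Finset.mem_product, mem_dyBlock, mem_dyBlock] at hp
    rw [Finset.mem_Ioc]
    have h1 : 0 < p.1 := lt_of_lt_of_le (Nat.two_pow_pos i) hp.1.1
    have h2 : 0 < p.2 + s := by have := Nat.two_pow_pos j; omega
    refine ⟨Nat.mul_pos h1 h2, ?_⟩
    calc p.1 * (p.2 + s) ≤ 2 ^ (i + 1) * 2 ^ (j + 2) := by
          refine Nat.mul_le_mul hp.1.2.le ?_
          have : 2 ^ (j + 2) = 2 ^ (j + 1) + 2 ^ (j + 1) := by rw [pow_succ]; ring
          omega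
      _ = Y := by rw [hY, ← pow_add]; ring_nf
  -- Cauchy–Schwarz
  have h3 : ∑ x ∈ P.image f, ((P.filter fun p => f p = x).card : ℝ) * g x ≤
      ∑ x ∈ Ioc 0 Y, ((Nat.divisors x).card : ℝ) * g x := by
    calc ∑ x ∈ P.image f, ((P.filter fun p => f p = x).card : ℝ) * g x
        ≤ ∑ x ∈ P.image f, ((Nat.divisors x).card : ℝ) * g x :=
          Finset.sum_le_sum fun x hx => mul_le_mul_of_nonneg_right (hfib x hx) (hg x)
      _ ≤ ∑ x ∈ Ioc 0 Y, ((Nat.divisors x).card : ℝ) * g x :=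
          Finset.sum_le_sum_of_subset_of_nonneg himg fun x _ _ => mul_nonneg (Nat.cast_nonneg _) (hg x)
  have hCS := Finset.sum_mul_sq_le_sq_mul_sq (Ioc 0 Y) (fun x => ((Nat.divisors x).card : ℝ)) g
  have hτ : ∑ x ∈ Ioc 0 Y, ((Nat.divisors x).card : ℝ) ^ 2 ≤ (Y : ℝ) * (1 + Real.log Y) ^ 3 := by
    have h := Literature.NumberTheory.Sieve.Vaughan.sum_sq_card_divisors_le Y
    refine le_trans (le_of_eq (Finset.sum_congr rfl fun x _ => ?_)) h
    norm_cast
  have hlog : 0 ≤ 1 + Real.log (Y : ℝ) := by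
    have : (1 : ℝ) ≤ Y := by rw [hY]; exact_mod_cast Nat.one_le_two_pow
    have := Real.log_nonneg this; linarith
  rw [h1, h2]
  refine h3.trans ?_
  have hA0 : 0 ≤ ∑ x ∈ Ioc 0 Y, ((Nat.divisors x).card : ℝ) * g x :=
    Finset.sum_nonneg fun x _ => mul_nonneg (Nat.cast_nonneg _) (hg x)
  have hY0 : 0 ≤ (Y : ℝ) * (1 + Real.log Y) ^ 3 := mul_nonneg (Nat.cast_nonneg _) (pow_nonneg hlog 3)
  rw [← Real.sqrt_mul hY0, ← Real.sqrt_sq hA0]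
  refine Real.sqrt_le_sqrt (hCS.trans ?_)
  exact mul_le_mul_of_nonneg_right hτ (Finset.sum_nonneg fun x _ => sq_nonneg _)

/-! ### Step 2: digit truncation to the window `[K, K + i + 2ρ + 3)` -/

/-- **One lag, one `b`: truncation up to the carry exceptions** (shifted window). For `a ∈ D_i`,
`1 ≤ d < 2^ρ`, `P = K + i + ρ + 1`, `T' = T ∩ [K, P + t)`:
`|∑_a w_T(a(b + d2^K)) w_T(ab)| ≤ |∑_a w_{T'}(a(b + d2^K)) w_{T'}(ab)| + 2 #{a ∈ D_i : ⌊ab/2^P⌋ ≡ -1 (2^t)}`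
(tree: `MoebiusWalshTypeII.natWalsh_mul_natWalsh_add_eq_window`, shift `δ = ad2^K`, `2^K ∣ δ < 2^P`).
[cite: Bourgain2013MoebiusWalsh, §2 (after (2.2)), "cf. Lemma 5 in [M-R]"] -/
theorem abs_sum_mul_le_window_add_carry (T : Finset ℕ) (i K ρ t b : ℕ) {d : ℕ} (hd : d < 2 ^ ρ) :
    |∑ a ∈ dyBlock i, natWalsh T (a * (b + d * 2 ^ K)) * natWalsh T (a * b)| ≤
      |∑ a ∈ dyBlock i,
          natWalsh (T.filter fun j => K ≤ j ∧ j < (K + i + ρ + 1) + t) (a * (b + d * 2 ^ K)) *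
            natWalsh (T.filter fun j => K ≤ j ∧ j < (K + i + ρ + 1) + t) (a * b)| +
        2 * ((dyBlock i).filter fun a => (a * b / 2 ^ (K + i + ρ + 1)) % 2 ^ t = 2 ^ t - 1).card := by
  classical
  set P : ℕ := K + i + ρ + 1 with hP
  set T' := T.filter fun j => K ≤ j ∧ j < P + t with hT'
  set u : ℕ → ℝ := fun a => natWalsh T (a * (b + d * 2 ^ K)) * natWalsh T (a * b) with hu
  set v : ℕ → ℝ := fun a => natWalsh T' (a * (b + d * 2 ^ K)) * natWalsh T' (a * b) with hv
  have hgood : ∀ a ∈ dyBlock i, (a * b / 2 ^ P) % 2 ^ t ≠ 2 ^ t - 1 → u a = v a := by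
    intro a ha hg
    rw [mem_dyBlock] at ha
    have hδ : 2 ^ K ∣ a * d * 2 ^ K := Dvd.intro_left _ rfl
    have hδw : a * d * 2 ^ K < 2 ^ P := by
      calc a * d * 2 ^ K < 2 ^ (i + 1) * 2 ^ ρ * 2 ^ K := by
            have h1 : a * d < 2 ^ (i + 1) * 2 ^ ρ :=
              lt_of_le_of_lt (Nat.mul_le_mul_left a hd.le) (Nat.mul_lt_mul_of_pos_right ha.2 (Nat.two_pow_pos ρ))
            exact Nat.mul_lt_mul_of_pos_right h1 (Nat.two_pow_pos K)
        _ = 2 ^ P := by rw [hP, ← pow_add, ← pow_add]; ring_nf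
    have e : a * (b + d * 2 ^ K) = a * b + a * d * 2 ^ K := by ring
    simp only [hu, hv, e]
    exact natWalsh_mul_natWalsh_add_eq_window T hδ hδw hg
  have hdiff : ∀ a, |u a - v a| ≤ 2 := by
    intro a
    have h1 : |u a| ≤ 1 := by
      simp only [hu, abs_mul, abs_natWalsh]; norm_num
    have h2 : |v a| ≤ 1 := by
      simp only [hv, abs_mul, abs_natWalsh]; norm_num
    calc |u a - v a| ≤ |u a| + |v a| := abs_sub _ _
      _ ≤ 2 := by linarith
  have hsum : |∑ a ∈ dyBlock i, (u a - v a)| ≤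
      2 * ((dyBlock i).filter fun a => (a * b / 2 ^ P) % 2 ^ t = 2 ^ t - 1).card := by
    calc |∑ a ∈ dyBlock i, (u a - v a)| ≤ ∑ a ∈ dyBlock i, |u a - v a| := Finset.abs_sum_le_sum_abs _ _
      _ = ∑ a ∈ (dyBlock i).filter (fun a => (a * b / 2 ^ P) % 2 ^ t = 2 ^ t - 1), |u a - v a| := by
          rw [← Finset.sum_filter_add_sum_filter_not (dyBlock i) (fun a => (a * b / 2 ^ P) % 2 ^ t = 2 ^ t - 1)]
          have : ∑ a ∈ (dyBlock i).filter (fun a => ¬ (a * b / 2 ^ P) % 2 ^ t = 2 ^ t - 1), |u a - v a| = 0 := by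
            refine Finset.sum_eq_zero fun a ha => ?_
            rw [Finset.mem_filter] at ha
            rw [hgood a ha.1 ha.2, sub_self, abs_zero]
          rw [this, add_zero]
      _ ≤ ∑ _a ∈ (dyBlock i).filter (fun a => (a * b / 2 ^ P) % 2 ^ t = 2 ^ t - 1), (2 : ℝ) :=
          Finset.sum_le_sum fun a _ => hdiff a
      _ = _ := by rw [Finset.sum_const, nsmul_eq_mul, mul_comm]
  have e : ∑ a ∈ dyBlock i, u a = ∑ a ∈ dyBlock i, v a + ∑ a ∈ dyBlock i, (u a - v a) := by
    rw [← Finset.sum_add_distrib]; refine Finset.sum_congr rfl fun a _ => by ring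
  calc |∑ a ∈ dyBlock i, u a| = |∑ a ∈ dyBlock i, v a + ∑ a ∈ dyBlock i, (u a - v a)| := by rw [e]
    _ ≤ |∑ a ∈ dyBlock i, v a| + |∑ a ∈ dyBlock i, (u a - v a)| := abs_add_le _ _
    _ ≤ _ := add_le_add le_rfl hsum

/-- **The carry exceptions are few** (shifted window): with `t = ρ + 2`, `P = K + i + ρ + 1`,
`1 ≤ ρ`, `4ρ < K`, `K + ρ ≤ j`:
`∑_{a ∈ D_i} #{b ∈ D_j : ⌊ab/2^P⌋ ≡ -1 (2^t)} ≤ 3·2^i 2^j/2^ρ` — empty when `K ≥ j - 2ρ` (the window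
reaches the top digit of the products), and by the tree's progression count
`MoebiusWalshTypeII.card_filter_carry_le` otherwise. [cite: Bourgain2013MoebiusWalsh, §2 (after (2.2))] -/
theorem sum_card_carry_le (i j K ρ : ℕ) (hρ : 1 ≤ ρ) (hK4 : 4 * ρ < K) (hKj : K + ρ ≤ j) :
    ∑ a ∈ dyBlock i,
        (((dyBlock j).filter fun b => (a * b / 2 ^ (K + i + ρ + 1)) % 2 ^ (ρ + 2) = 2 ^ (ρ + 2) - 1).card : ℝ) ≤
      3 * (2 : ℝ) ^ i * 2 ^ j / 2 ^ ρ := by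
  classical
  set P : ℕ := K + i + ρ + 1 with hP
  set t : ℕ := ρ + 2 with ht
  by_cases hhigh : j ≤ K + 2 * ρ
  · -- the window reaches the top: no exceptions at all
    have hempty : ∀ a ∈ dyBlock i,
        ((dyBlock j).filter fun b => (a * b / 2 ^ P) % 2 ^ t = 2 ^ t - 1) = ∅ := by
      intro a ha
      rw [Finset.filter_eq_empty_iff]
      intro b hb hbad
      rw [mem_dyBlock] at ha hb
      have h1 : 2 ^ t - 1 ≤ a * b / 2 ^ P := by
        have := Nat.mod_le (a * b / 2 ^ P) (2 ^ t)
        omega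
      have h2 : 2 ^ P * (2 ^ t - 1) ≤ a * b := by
        calc 2 ^ P * (2 ^ t - 1) ≤ 2 ^ P * (a * b / 2 ^ P) := Nat.mul_le_mul_left _ h1
          _ ≤ a * b := Nat.mul_div_le _ _
      have h3 : a * b < 2 ^ (i + j + 2) := by
        calc a * b < 2 ^ (i + 1) * 2 ^ (j + 1) := Nat.mul_lt_mul'' ha.2 hb.2
          _ = 2 ^ (i + j + 2) := by rw [← pow_add]; ring_nf
      have h4 : 2 ^ (i + j + 2) ≤ 2 ^ P * (2 ^ t - 1) := by
        have h5 : 2 ^ (t - 1) ≤ 2 ^ t - 1 := by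
          have : 2 ^ t = 2 * 2 ^ (t - 1) := by
            rw [← pow_succ']; congr 1
          have := Nat.two_pow_pos (t - 1)
          omega
        calc 2 ^ (i + j + 2) ≤ 2 ^ (P + (t - 1)) := Nat.pow_le_pow_right (by norm_num) (by omega)
          _ = 2 ^ P * 2 ^ (t - 1) := pow_add _ _ _
          _ ≤ 2 ^ P * (2 ^ t - 1) := Nat.mul_le_mul_left _ h5
      omega
    rw [Finset.sum_congr rfl fun a ha => by rw [hempty a ha]]
    have : ∑ _x ∈ dyBlock i, (((∅ : Finset ℕ)).card : ℝ) = 0 := by simp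
    rw [this]
    positivity
  · -- below: the progression count
    have hlow : K + 2 * ρ + 1 ≤ j := by omega
    have hterm : ∀ a ∈ dyBlock i,
        (((dyBlock j).filter fun b => (a * b / 2 ^ P) % 2 ^ t = 2 ^ t - 1).card : ℝ) ≤ 12 * (2 : ℝ) ^ j / 2 ^ t := by
      intro a ha
      rw [mem_dyBlock] at ha
      have ha0 : 0 < a := lt_of_lt_of_le (Nat.two_pow_pos i) ha.1
      have h := card_filter_carry_le ha0 P t (show 2 ^ j ≤ 2 ^ (j + 1) from Nat.pow_le_pow_right (by norm_num) (by omega))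
      rw [dyBlock]
      refine h.trans ?_
      have haR : (2 : ℝ) ^ i ≤ a := by exact_mod_cast ha.1
      have haR' : (a : ℝ) ≤ 2 ^ (i + 1) := by exact_mod_cast ha.2.le
      have ha0' : (0 : ℝ) < a := by exact_mod_cast ha0
      have hN : ((2 ^ (j + 1) : ℕ) : ℝ) - ((2 ^ j : ℕ) : ℝ) = (2 : ℝ) ^ j := by push_cast; ring
      rw [hN]
      -- `(N a / 2^{P+t} + 2)(2^P/a + 1) ≤ 12 N / 2^t`
      have h2t : (2 : ℝ) ^ t ≤ 2 ^ j := pow_le_pow_right₀ one_le_two (by omega)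
      have hPt : (2 : ℝ) ^ (P + t) = 2 ^ P * 2 ^ t := pow_add _ _ _
      have hP1 : (2 : ℝ) ^ P = 2 ^ K * 2 ^ i * 2 ^ (ρ + 1) := by
        rw [hP, ← pow_add, ← pow_add]; ring_nf
      have hKlow : (2 : ℝ) ^ K * 2 ^ (ρ + 1) * 2 ^ t ≤ 2 ^ j * 2 ^ 2 := by
        rw [← pow_add, ← pow_add, ← pow_add]
        exact pow_le_pow_right₀ one_le_two (by omega)
      set X : ℝ := (2 : ℝ) ^ j / 2 ^ t with hX
      set u : ℝ := (2 : ℝ) ^ j * a / 2 ^ (P + t) with hu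
      set v : ℝ := (2 : ℝ) ^ P / a with hv
      have e1 : u ≤ X := by
        rw [hu, hX, hPt, div_le_div_iff₀ (by positivity) (by positivity)]
        have : (a : ℝ) ≤ 2 ^ P := by
          rw [hP1]
          calc (a : ℝ) ≤ 2 ^ (i + 1) := haR'
            _ = 1 * 2 ^ i * 2 ^ 1 := by rw [pow_succ]; ring
            _ ≤ 2 ^ K * 2 ^ i * 2 ^ (ρ + 1) := by
                gcongr
                · exact one_le_pow₀ one_le_two
                · norm_num
                · omega
        have h0 : (0 : ℝ) ≤ 2 ^ j * 2 ^ t := by positivity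
        nlinarith
      have e2 : v ≤ 4 * X := by
        rw [hv, hX, mul_div_assoc', div_le_div_iff₀ ha0' (by positivity), hP1]
        calc (2 : ℝ) ^ K * 2 ^ i * 2 ^ (ρ + 1) * 2 ^ t = 2 ^ i * (2 ^ K * 2 ^ (ρ + 1) * 2 ^ t) := by ring
          _ ≤ a * (2 ^ j * 2 ^ 2) := mul_le_mul haR hKlow (by positivity) (by positivity)
          _ = 4 * 2 ^ j * a := by ring
      have e3 : (1 : ℝ) ≤ X := by rw [hX, le_div_iff₀ (by positivity)]; linarith
      have huv : u * v = X := by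
        rw [hu, hv, hX, hPt]
        field_simp
      calc (u + 2) * (v + 1) = u * v + u + 2 * v + 2 := by ring
        _ ≤ X + X + 2 * (4 * X) + 2 * X := by rw [huv]; linarith
        _ = 12 * X := by ring
        _ = 12 * (2 : ℝ) ^ j / 2 ^ t := by rw [hX]; ring
    calc ∑ a ∈ dyBlock i, (((dyBlock j).filter fun b => (a * b / 2 ^ P) % 2 ^ t = 2 ^ t - 1).card : ℝ)
        ≤ ∑ _a ∈ dyBlock i, 12 * (2 : ℝ) ^ j / 2 ^ t := Finset.sum_le_sum hterm
      _ = 2 ^ i * (12 * (2 : ℝ) ^ j / 2 ^ t) := by rw [Finset.sum_const, card_dyBlock, nsmul_eq_mul]; push_cast; ring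
      _ = 3 * (2 : ℝ) ^ i * 2 ^ j / 2 ^ ρ := by
          rw [ht, pow_add]; field_simp; ring

/-! ### Step 3: the localised substitute `W` (Lemma 5) and the replacement error (2.3)–(2.4) -/

section Localised

variable (K σ K₁ : ℕ) (A : Finset (Fin (K + σ)))

/-- `W` is `2^{K+σ}`-periodic. [folklore] -/
theorem localisedWalshRe_add_two_pow (x : ℕ) :
    localisedWalshRe K σ K₁ A (x + 2 ^ (K + σ)) = localisedWalshRe K σ K₁ A x := by
  unfold localisedWalshRe
  rw [Literature.NumberTheory.LFunctions.MoebiusWalsh.localisedWalsh_add_two_pow]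

/-- The squared replacement error is `2^{K+σ}`-periodic. [folklore] -/
theorem periodic_sq_sub :
    Function.Periodic (fun x : ℕ => (localisedWalshRe K σ K₁ A x - walshNat A x) ^ 2) (2 ^ (K + σ)) := by
  intro x
  simp only [localisedWalshRe_add_two_pow,
    Literature.NumberTheory.LFunctions.MoebiusWalsh.walshNat_add_two_pow]

/-- `|W| ≤ 3` for `2K₁ ≤ 2^K`, `0 < K₁`. [cite: Bourgain2013MoebiusWalsh, Lemma 5 (1.22)] -/
theorem abs_localisedWalshRe_le_three (hK : 0 < K₁) (h2 : 2 * K₁ ≤ 2 ^ K) (x : ℕ) :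
    |localisedWalshRe K σ K₁ A x| ≤ 3 := by
  have h2N : 2 * (K₁ * 2 ^ σ) ≤ 2 ^ (K + σ) := by
    rw [pow_add, ← mul_assoc]; exact Nat.mul_le_mul_right _ h2
  have h := Literature.NumberTheory.LFunctions.MoebiusWalsh.norm_localisedWalsh_le hK h2N A x
  unfold localisedWalshRe
  exact (Complex.abs_re_le_norm _).trans h

/-- **The `ℓ²` error of the substitute over `(0, Y]`** (periodicity and (1.12)):
`∑_{0 < x ≤ Y} (W x - w_A x)² ≤ (Y/2^{K+σ} + 2) · 2^{K+σ}/(2(K₁-1))` for `K₁ ≥ 2`, `4K₁ ≤ 2^K`, all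
digits of `A` being `≥ K`. [cite: Bourgain2013MoebiusWalsh, Lemma 5 (1.12), §2 (2.4)] -/
theorem sum_Ioc_sq_sub_le (hA : ∀ j ∈ A, K ≤ (j : ℕ)) (hK₁ : 2 ≤ K₁) (hKq : 4 * K₁ ≤ 2 ^ K) (Y : ℕ) :
    ∑ x ∈ Ioc 0 Y, (localisedWalshRe K σ K₁ A x - walshNat A x) ^ 2 ≤
      ((Y : ℝ) / 2 ^ (K + σ) + 2) * (2 ^ (K + σ) / (2 * ((K₁ : ℝ) - 1))) := by
  have hper := periodic_sq_sub K σ K₁ A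
  have hB : ∀ t : ℕ, ∑ k ∈ range (2 ^ (K + σ)),
      (localisedWalshRe K σ K₁ A (2 ^ (K + σ) * t + k) - walshNat A (2 ^ (K + σ) * t + k)) ^ 2 ≤
        2 ^ (K + σ) / (2 * ((K₁ : ℝ) - 1)) := by
    intro t
    have hsq := Literature.NumberTheory.LFunctions.MoebiusWalsh.sum_norm_sq_localisedWalsh_sub_walshNat_le
      A hA hK₁ hKq
    refine le_trans (le_of_eq (Finset.sum_congr rfl fun k _ => ?_)) hsq
    have e1 : 2 ^ (K + σ) * t + k = k + t * 2 ^ (K + σ) := by ring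
    have e2 := hper.nat_mul t k
    simp only [Nat.cast_id] at e2
    rw [e1, e2, ← Literature.NumberTheory.LFunctions.MoebiusWalsh.coe_localisedWalshRe,
      ← Complex.ofReal_sub, Complex.norm_real, Real.norm_eq_abs, sq_abs]
  have hIoc : Ioc 0 Y = Ico 1 (1 + Y) := by
    ext x; simp only [Finset.mem_Ioc, Finset.mem_Ico]; omega
  rw [hIoc]
  have h := Literature.NumberTheory.LFunctions.MoebiusWalsh.sum_Ico_le_of_period_bound
    (g := fun x : ℕ => (localisedWalshRe K σ K₁ A x - walshNat A x) ^ 2) (fun x => sq_nonneg _)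
    (Nat.two_pow_pos (K + σ)) hB 1 Y
  refine h.trans (le_of_eq ?_)
  push_cast; ring

end Localised

/-- **Replacing `w_{T'}` by `W` in the differenced sums** (Bourgain 2013, (2.3)–(2.4)): with
`w = walshNat A` (all digits of `A` in `[K, K+σ)`), `W` its localised substitute (`K₁ ≥ 2`,
`4K₁ ≤ 2^K`), `(L-1)2^K ≤ 2^j`, `Y = 2^{i+j+3}`:
`∑_{1≤d<L} ∑_{b ∈ D_j} |∑_{a ∈ D_i} w(a(b+d2^K)) w(ab)| ≤ ∑_d ∑_b |∑_a W(a(b+d2^K)) W(ab)| + 4(L-1) √(Y(1+log Y)³) √E₂`,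
`E₂ = (Y/2^{K+σ} + 2) 2^{K+σ}/(2(K₁-1))` (pointwise `|ww' - WW'| ≤ |w-W|(ab) + 3|w-W|(a(b+d2^K))`,
multiplicities `≤ τ`, Cauchy–Schwarz). [cite: Bourgain2013MoebiusWalsh, §2 (2.3)–(2.4)] -/
theorem sum_abs_le_localised_add_error (K σ K₁ : ℕ) (A : Finset (Fin (K + σ)))
    (hA : ∀ j' ∈ A, K ≤ (j' : ℕ)) (hK₁ : 2 ≤ K₁) (hKq : 4 * K₁ ≤ 2 ^ K)
    (i j : ℕ) {L : ℕ} (hLK : (L - 1) * 2 ^ K ≤ 2 ^ j) :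
    ∑ d ∈ Ico 1 L, ∑ b ∈ dyBlock j, |∑ a ∈ dyBlock i, walshNat A (a * (b + d * 2 ^ K)) * walshNat A (a * b)| ≤
      ∑ d ∈ Ico 1 L, ∑ b ∈ dyBlock j,
          |∑ a ∈ dyBlock i, localisedWalshRe K σ K₁ A (a * (b + d * 2 ^ K)) * localisedWalshRe K σ K₁ A (a * b)| +
        4 * ((L - 1 : ℕ) : ℝ) *
          (Real.sqrt ((2 ^ (i + j + 3) : ℕ) * (1 + Real.log ((2 ^ (i + j + 3) : ℕ))) ^ 3) *
            Real.sqrt (((2 ^ (i + j + 3) : ℕ) / (2 : ℝ) ^ (K + σ) + 2) * (2 ^ (K + σ) / (2 * ((K₁ : ℝ) - 1))))) := by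
  classical
  set w : ℕ → ℝ := fun x => walshNat A x with hw
  set W : ℕ → ℝ := fun x => localisedWalshRe K σ K₁ A x with hW
  set g : ℕ → ℝ := fun x => |w x - W x| with hg
  have hg0 : ∀ x, 0 ≤ g x := fun x => abs_nonneg _
  have hK0 : 0 < K₁ := by omega
  have h2K : 2 * K₁ ≤ 2 ^ K := by omega
  have hW3 : ∀ x, |W x| ≤ 3 := fun x => abs_localisedWalshRe_le_three K σ K₁ A hK0 h2K x
  have hw1 : ∀ x, |w x| = 1 := fun x => Literature.NumberTheory.LFunctions.MoebiusWalsh.abs_walshNat A x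
  -- pointwise
  have hpt : ∀ x y, |w x * w y - W x * W y| ≤ g y + 3 * g x := by
    intro x y
    have e : w x * w y - W x * W y = w x * (w y - W y) + (w x - W x) * W y := by ring
    rw [e]
    calc |w x * (w y - W y) + (w x - W x) * W y|
        ≤ |w x * (w y - W y)| + |(w x - W x) * W y| := abs_add_le _ _
      _ = |w x| * g y + g x * |W y| := by rw [abs_mul, abs_mul]
      _ ≤ 1 * g y + g x * 3 := by
          rw [hw1 x]
          have := hW3 y
          have := hg0 x
          nlinarith
      _ = g y + 3 * g x := by ring
  -- one (d, b)
  have hdb : ∀ d b, |∑ a ∈ dyBlock i, w (a * (b + d * 2 ^ K)) * w (a * b)| ≤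
      |∑ a ∈ dyBlock i, W (a * (b + d * 2 ^ K)) * W (a * b)| +
        ∑ a ∈ dyBlock i, (g (a * b) + 3 * g (a * (b + d * 2 ^ K))) := by
    intro d b
    have e : ∑ a ∈ dyBlock i, w (a * (b + d * 2 ^ K)) * w (a * b) =
        ∑ a ∈ dyBlock i, W (a * (b + d * 2 ^ K)) * W (a * b) +
          ∑ a ∈ dyBlock i, (w (a * (b + d * 2 ^ K)) * w (a * b) - W (a * (b + d * 2 ^ K)) * W (a * b)) := by
      rw [← Finset.sum_add_distrib]; refine Finset.sum_congr rfl fun a _ => by ring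
    rw [e]
    refine (abs_add_le _ _).trans (add_le_add le_rfl ?_)
    refine (Finset.abs_sum_le_sum_abs _ _).trans (Finset.sum_le_sum fun a _ => hpt _ _)
  -- the error sums via the divisor lemma
  set CS : ℝ := Real.sqrt ((2 ^ (i + j + 3) : ℕ) * (1 + Real.log ((2 ^ (i + j + 3) : ℕ))) ^ 3) *
    Real.sqrt (∑ x ∈ Ioc 0 (2 ^ (i + j + 3)), g x ^ 2) with hCS
  have hshift : ∀ d ∈ Ico 1 L, ∑ a ∈ dyBlock i, ∑ b ∈ dyBlock j, g (a * (b + d * 2 ^ K)) ≤ CS := by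
    intro d hd
    rw [Finset.mem_Ico] at hd
    refine sum_sum_shift_le_sqrt i j (d * 2 ^ K) ?_ hg0
    calc d * 2 ^ K ≤ (L - 1) * 2 ^ K := Nat.mul_le_mul_right _ (by omega)
      _ ≤ 2 ^ j := hLK
      _ ≤ 2 ^ (j + 1) := Nat.pow_le_pow_right (by norm_num) (by omega)
  have hzero : ∑ a ∈ dyBlock i, ∑ b ∈ dyBlock j, g (a * b) ≤ CS := by
    have := sum_sum_shift_le_sqrt i j 0 (Nat.zero_le _) hg0
    simp only [add_zero] at this
    exact this
  -- the `ℓ²` bound of `g`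
  have hg2 : ∑ x ∈ Ioc 0 (2 ^ (i + j + 3)), g x ^ 2 ≤
      (((2 ^ (i + j + 3) : ℕ) : ℝ) / 2 ^ (K + σ) + 2) * (2 ^ (K + σ) / (2 * ((K₁ : ℝ) - 1))) := by
    have h := sum_Ioc_sq_sub_le K σ K₁ A hA hK₁ hKq (2 ^ (i + j + 3))
    refine le_trans (le_of_eq (Finset.sum_congr rfl fun x _ => ?_)) h
    simp only [hg, hw, hW, sq_abs]; ring
  have hCSle : CS ≤ Real.sqrt ((2 ^ (i + j + 3) : ℕ) * (1 + Real.log ((2 ^ (i + j + 3) : ℕ))) ^ 3) *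
      Real.sqrt ((((2 ^ (i + j + 3) : ℕ) : ℝ) / 2 ^ (K + σ) + 2) * (2 ^ (K + σ) / (2 * ((K₁ : ℝ) - 1)))) := by
    rw [hCS]
    exact mul_le_mul_of_nonneg_left (Real.sqrt_le_sqrt hg2) (Real.sqrt_nonneg _)
  -- assemble
  calc ∑ d ∈ Ico 1 L, ∑ b ∈ dyBlock j, |∑ a ∈ dyBlock i, w (a * (b + d * 2 ^ K)) * w (a * b)|
      ≤ ∑ d ∈ Ico 1 L, ∑ b ∈ dyBlock j, (|∑ a ∈ dyBlock i, W (a * (b + d * 2 ^ K)) * W (a * b)| +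
          ∑ a ∈ dyBlock i, (g (a * b) + 3 * g (a * (b + d * 2 ^ K)))) :=
        Finset.sum_le_sum fun d _ => Finset.sum_le_sum fun b _ => hdb d b
    _ = ∑ d ∈ Ico 1 L, ∑ b ∈ dyBlock j, |∑ a ∈ dyBlock i, W (a * (b + d * 2 ^ K)) * W (a * b)| +
        ∑ d ∈ Ico 1 L, (∑ a ∈ dyBlock i, ∑ b ∈ dyBlock j, g (a * b) +
          3 * ∑ a ∈ dyBlock i, ∑ b ∈ dyBlock j, g (a * (b + d * 2 ^ K))) := by
        rw [← Finset.sum_add_distrib]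
        refine Finset.sum_congr rfl fun d _ => ?_
        rw [Finset.sum_add_distrib, Finset.sum_comm]
        congr 1
        simp only [Finset.sum_add_distrib, Finset.mul_sum]
    _ ≤ ∑ d ∈ Ico 1 L, ∑ b ∈ dyBlock j, |∑ a ∈ dyBlock i, W (a * (b + d * 2 ^ K)) * W (a * b)| +
        ∑ _d ∈ Ico 1 L, (CS + 3 * CS) := by
        refine add_le_add le_rfl (Finset.sum_le_sum fun d hd => ?_)
        exact add_le_add hzero (mul_le_mul_of_nonneg_left (hshift d hd) (by norm_num))
    _ = ∑ d ∈ Ico 1 L, ∑ b ∈ dyBlock j, |∑ a ∈ dyBlock i, W (a * (b + d * 2 ^ K)) * W (a * b)| +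
        4 * ((L - 1 : ℕ) : ℝ) * CS := by
        rw [Finset.sum_const, Nat.card_Ico, nsmul_eq_mul]; ring
    _ ≤ _ := by
        refine add_le_add le_rfl ?_
        exact mul_le_mul_of_nonneg_left hCSle (by positivity)

/-! ### The window bound with `B = 16` for windows up to `4·2^{K+σ}` -/

/-- Splitting a window of `J ≤ 4·2^{K+σ}` consecutive frequencies into four windows of length
`⌈J/4⌉ ≤ 2^{K+σ}`: `∑_{a ≤ k < a+J} |c(k)| ≤ 16 J^κ`. [cite: Bourgain2013MoebiusWalsh, Lemma 6 (1.24)] -/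
theorem sum_Ico_norm_localisedCoeff_le_sixteen (K σ K₁ : ℕ) (A : Finset (Fin (K + σ))) (a : ℤ) {J : ℕ}
    (hJ1 : 1 ≤ J) (hJ : J ≤ 4 * 2 ^ (K + σ)) :
    ∑ k ∈ Ico a (a + J), ‖localisedCoeff K σ K₁ A k‖ ≤ 16 * (J : ℝ) ^ walshL1Exponent := by
  set Q' : ℕ := (J + 3) / 4 with hQ'
  have hQ'1 : 1 ≤ Q' := by omega
  have hQ'Q : Q' ≤ 2 ^ (K + σ) := by omega
  have hQ'J : Q' ≤ J := by omega
  have h4 : J ≤ 4 * Q' := by omega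
  have hwin : ∀ m : ℕ, ∑ k ∈ Ico (a + m * Q') (a + m * Q' + Q'), ‖localisedCoeff K σ K₁ A k‖ ≤
      4 * (Q' : ℝ) ^ walshL1Exponent := fun m =>
    Literature.NumberTheory.LFunctions.MoebiusWalsh.sum_Ico_norm_localisedCoeff_le K σ K₁ A _ hQ'1 hQ'Q
  have hsplit : ∑ k ∈ Ico a (a + 4 * Q'), ‖localisedCoeff K σ K₁ A k‖ =
      ∑ m ∈ range 4, ∑ k ∈ Ico (a + m * Q') (a + m * Q' + Q'), ‖localisedCoeff K σ K₁ A k‖ := by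
    have key : ∀ n : ℕ, ∑ k ∈ Ico a (a + n * Q'), ‖localisedCoeff K σ K₁ A k‖ =
        ∑ m ∈ range n, ∑ k ∈ Ico (a + m * Q') (a + m * Q' + Q'), ‖localisedCoeff K σ K₁ A k‖ := by
      intro n
      induction n with
      | zero => simp
      | succ n ih =>
        rw [Finset.sum_range_succ, ← ih,
          Literature.NumberTheory.LFunctions.MoebiusWalsh.sum_Ico_int_split _ (b := a + n * Q')
            (by nlinarith) (by push_cast; nlinarith)]
        congr 1
        congr 1
        push_cast; ring
    have := key 4
    push_cast at this ⊢
    exact this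
  calc ∑ k ∈ Ico a (a + J), ‖localisedCoeff K σ K₁ A k‖
      ≤ ∑ k ∈ Ico a (a + 4 * Q'), ‖localisedCoeff K σ K₁ A k‖ := by
        refine Finset.sum_le_sum_of_subset_of_nonneg (Finset.Ico_subset_Ico le_rfl ?_) fun _ _ _ => norm_nonneg _
        have : (J : ℤ) ≤ 4 * (Q' : ℤ) := by exact_mod_cast h4
        linarith
    _ = ∑ m ∈ range 4, ∑ k ∈ Ico (a + m * Q') (a + m * Q' + Q'), ‖localisedCoeff K σ K₁ A k‖ := hsplit
    _ ≤ ∑ _m ∈ range 4, 4 * (Q' : ℝ) ^ walshL1Exponent := Finset.sum_le_sum fun m _ => hwin m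
    _ = 16 * (Q' : ℝ) ^ walshL1Exponent := by rw [Finset.sum_const, Finset.card_range, nsmul_eq_mul]; ring
    _ ≤ 16 * (J : ℝ) ^ walshL1Exponent :=
        mul_le_mul_of_nonneg_left (Real.rpow_le_rpow (Nat.cast_nonneg _) (by exact_mod_cast hQ'J)
          walshL1Exponent_pos.le) (by norm_num)


/-! ### Step 4: Fourier expansion of the localised product and the pair count -/

open Literature.NumberTheory.LFunctions.MoebiusWalsh (pairPhase typeII_count_high
  sum_Ioo_mul_geomBound_le_sup abs_sum_Ico_localisedWalshRe_mul_le norm_localisedCoeff_le_sup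
  sum_Ioo_norm_localisedCoeff_le)

/-- The phase of `pairPhase` with the frequencies renamed is the phase of `typeII_count_high`.
[folklore] -/
theorem pairPhase_swap_eq (K σ d : ℕ) (k k' : ℤ) (n : ℕ) :
    pairPhase K σ (d : ℤ) k' k n = (((k' - k) * n + k' * d * 2 ^ K : ℤ) : ℝ) / 2 ^ (K + σ) := by
  unfold pairPhase
  rw [pow_add]
  push_cast
  field_simp

/-- **One lag `d ≥ 1`: the localised differenced sum against the pair count** (Bourgain 2013,
(2.11)–(2.12), (2.13)–(2.14) and the HIGH-window count (2.23)–(2.28) of the tree's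
`typeII_count_high`). With `c = |Ŵ|` (`F = 2K₁2^σ` frequencies, `4F ≤ 2^{K+σ}`, `4K₁ ≤ 2^K`, all
digits of `A` being `≥ K`), `M = 2^i`, `N = 2^j ≥ 2^K`, `|d| ≤ L`, `D₀ ≥ 1`:
`∑_{b ∈ D_j} |∑_{a ∈ D_i} W(a(b + d2^K)) W(ab)| ≤ N η² (2F/2^σ + 2)(2^{v₂(d)+1} M + 2^σ(1 + log 2^σ)) + (K+σ)(T_A + T_{B1} + T_{B2})`
with `η = 2·2^{-c₂|A|}`, `A₁ = 4(K+2)2^{κσ}`, `B = 16` in the three regime terms.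
[cite: Bourgain2013MoebiusWalsh, §2 (2.11)–(2.14), (2.23)–(2.28)] -/
theorem sum_abs_localised_le_count (K σ K₁ : ℕ) (A : Finset (Fin (K + σ)))
    (hA : ∀ j' ∈ A, K ≤ (j' : ℕ)) (hKq : 4 * K₁ ≤ 2 ^ K) (hF : 4 * (2 * (K₁ * 2 ^ σ)) ≤ 2 ^ (K + σ))
    (i j : ℕ) (hKj : K ≤ j) {d : ℕ} (hd : 1 ≤ d) {L : ℝ} (hdL : (d : ℝ) ≤ L) {D₀ : ℕ} (hD₀ : 1 ≤ D₀) :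
    ∑ b ∈ dyBlock j, |∑ a ∈ dyBlock i, localisedWalshRe K σ K₁ A (a * (b + d * 2 ^ K)) *
        localisedWalshRe K σ K₁ A (a * b)| ≤
      ((2 ^ j : ℕ) : ℝ) * ((2 * (2 : ℝ) ^ (-(walshSupExponent * A.card))) ^ 2 *
        ((2 * ((2 * (K₁ * 2 ^ σ) : ℕ) : ℝ)) / 2 ^ σ + 2) *
          (2 ^ (d.factorization 2 + 1) * (2 : ℝ) ^ i + 2 ^ σ * (1 + Real.log (2 ^ σ)))) +
      ((K + σ : ℕ) : ℝ) *
        ((4 * ((K : ℝ) + 2) * (2 : ℝ) ^ (walshL1Exponent * σ)) ^ 2 *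
            ((16 * ((2 * (K₁ * 2 ^ σ) : ℕ) : ℝ) * ((2 ^ j : ℕ) : ℝ) / 2 ^ (K + σ) + 1) * (2 * (2 : ℝ) ^ i) +
              24 * ((2 ^ j : ℕ) : ℝ) * (1 + Real.log (2 ^ (K + σ)))) +
        (136 * (16 : ℝ) ^ 2 * (2 * (((2 * (K₁ * 2 ^ σ) : ℕ) : ℝ) * L / 2 ^ σ) + 3) * (2 : ℝ) ^ i *
              ((2 : ℝ) ^ (K + σ) / (16 * ((2 ^ j : ℕ) : ℝ))) ^ (2 * walshL1Exponent) *
              ((((2 ^ j : ℕ) : ℝ)) / 2 ^ K) ^ walshL1Exponent +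
            68 * (16 : ℝ) ^ 2 * (2 * (((2 * (K₁ * 2 ^ σ) : ℕ) : ℝ) * L / 2 ^ σ) + 3) * 2 ^ (K + σ) *
              (1 + Real.log (2 ^ (K + σ))) *
              (D₀ : ℝ) ^ (2 * walshL1Exponent - 1) * ((((2 ^ j : ℕ) : ℝ)) / 2 ^ K) ^ walshL1Exponent +
            8 * 16 * ((2 ^ j : ℕ) : ℝ) * (4 * ((K : ℝ) + 2) * (2 : ℝ) ^ (walshL1Exponent * σ)) *
              ((2 : ℝ) ^ (K + σ) / (16 * ((2 ^ j : ℕ) : ℝ))) ^ walshL1Exponent +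
            16 * (16 : ℝ) ^ 2 * ((2 ^ j : ℕ) : ℝ) * ((K + σ : ℕ) : ℝ) * (2 * (((2 * (K₁ * 2 ^ σ) : ℕ) : ℝ) * L / 2 ^ σ) + 3) *
              ((2 : ℝ) ^ σ) ^ walshL1Exponent *
              ((2 : ℝ) ^ (K + σ) / (16 * ((2 ^ j : ℕ) : ℝ))) ^ (1 - walshL1Exponent) *
              (D₀ : ℝ) ^ (2 * walshL1Exponent - 1)) +
        (144 * 16 * (2 * (((2 * (K₁ * 2 ^ σ) : ℕ) : ℝ) * L / 2 ^ σ) + 3) *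
              (2 * (2 : ℝ) ^ (-(walshSupExponent * A.card))) * (2 : ℝ) ^ i * (D₀ : ℝ) ^ (1 + walshL1Exponent) *
              ((2 ^ j : ℕ) : ℝ) / 2 ^ K +
            72 * 16 * (2 * (((2 * (K₁ * 2 ^ σ) : ℕ) : ℝ) * L / 2 ^ σ) + 3) *
              (2 * (2 : ℝ) ^ (-(walshSupExponent * A.card))) * (1 + Real.log (2 ^ (K + σ))) *
              (D₀ : ℝ) ^ walshL1Exponent * 2 ^ (K + σ) * ((2 ^ j : ℕ) : ℝ) / 2 ^ K +
            8 * 16 * (D₀ : ℝ) ^ walshL1Exponent * ((2 ^ j : ℕ) : ℝ) *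
              (2 * (2 : ℝ) ^ (-(walshSupExponent * A.card))) *
              (2 * ((2 * (K₁ * 2 ^ σ) : ℕ) : ℝ) / 2 ^ σ + 2) *
              (2 * L * (2 : ℝ) ^ i + 2 ^ σ * (1 + Real.log (2 ^ (K + σ)))))) := by
  classical
  set F : ℕ := 2 * (K₁ * 2 ^ σ) with hFdef
  set c : ℤ → ℝ := fun k => ‖localisedCoeff K σ K₁ A k‖ with hc
  set η : ℝ := 2 * (2 : ℝ) ^ (-(walshSupExponent * A.card)) with hη
  set M : ℕ := 2 ^ i with hM
  set N : ℕ := 2 ^ j with hN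
  have hc0 : ∀ k, 0 ≤ c k := fun k => norm_nonneg _
  have hcη : ∀ k, c k ≤ η := fun k => norm_localisedCoeff_le_sup K σ K₁ A k
  have hη0 : 0 ≤ η := by rw [hη]; positivity
  -- expansion (2.11): one `b`
  have hexp : ∀ b, |∑ a ∈ dyBlock i, localisedWalshRe K σ K₁ A (a * (b + d * 2 ^ K)) *
      localisedWalshRe K σ K₁ A (a * b)| ≤
      ∑ k ∈ Ioo (-(F : ℤ)) F, ∑ k' ∈ Ioo (-(F : ℤ)) F, c k * c k' * geomBound M (pairPhase K σ d k k' b) := by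
    intro b
    have h := abs_sum_Ico_localisedWalshRe_mul_le K σ K₁ A b d M M
    rw [← dyBlock_eq_Ico_add] at h
    exact h
  -- rename the frequencies: `∑_{k,k'} f(k,k') = ∑_{k,k'} f(k',k)`
  have hswap : ∀ b, ∑ k ∈ Ioo (-(F : ℤ)) F, ∑ k' ∈ Ioo (-(F : ℤ)) F, c k * c k' * geomBound M (pairPhase K σ d k k' b) =
      ∑ k ∈ Ioo (-(F : ℤ)) F, ∑ k' ∈ Ioo (-(F : ℤ)) F,
        c k * c k' * geomBound M ((((k' - k) * b + k' * d * 2 ^ K : ℤ) : ℝ) / 2 ^ (K + σ)) := by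
    intro b
    rw [Finset.sum_comm]
    refine Finset.sum_congr rfl fun k _ => Finset.sum_congr rfl fun k' _ => ?_
    rw [pairPhase_swap_eq, mul_comm (c k') (c k)]
  -- split off the diagonal
  have hsplit : ∀ b : ℕ, ∑ k ∈ Ioo (-(F : ℤ)) F, ∑ k' ∈ Ioo (-(F : ℤ)) F,
        c k * c k' * geomBound M ((((k' - k) * b + k' * d * 2 ^ K : ℤ) : ℝ) / 2 ^ (K + σ)) =
      ∑ k ∈ Ioo (-(F : ℤ)) F, c k * c k * geomBound M (((k * d : ℤ) : ℝ) / 2 ^ σ) +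
      ∑ k ∈ Ioo (-(F : ℤ)) F, ∑ k' ∈ (Ioo (-(F : ℤ)) F).erase k,
        c k * c k' * geomBound M ((((k' - k) * b + k' * d * 2 ^ K : ℤ) : ℝ) / 2 ^ (K + σ)) := by
    intro b
    rw [← Finset.sum_add_distrib]
    refine Finset.sum_congr rfl fun k hk => ?_
    rw [← Finset.add_sum_erase _ _ hk]
    congr 1
    congr 1
    have : (((k - k) * b + k * d * 2 ^ K : ℤ) : ℝ) / 2 ^ (K + σ) = ((k * d : ℤ) : ℝ) / 2 ^ σ := by
      rw [pow_add]; push_cast; field_simp; ring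
    rw [this]
  -- the diagonal (2.13)–(2.14)
  have hd0 : (d : ℤ) ≠ 0 := by exact_mod_cast (by omega : d ≠ 0)
  have hdiag : ∑ k ∈ Ioo (-(F : ℤ)) F, c k * c k * geomBound M (((k * d : ℤ) : ℝ) / 2 ^ σ) ≤
      η ^ 2 * ((2 * (F : ℝ)) / 2 ^ σ + 2) *
        (2 ^ ((d : ℤ).natAbs.factorization 2 + 1) * (M : ℝ) + 2 ^ σ * (1 + Real.log (2 ^ σ))) := by
    have h := sum_Ioo_mul_geomBound_le_sup (c := fun k => c k * c k) (Ainf := η ^ 2) (by positivity)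
      (fun k => by
        calc c k * c k ≤ η * η := mul_le_mul (hcη k) (hcη k) (hc0 k) hη0
          _ = η ^ 2 := (sq η).symm)
      F σ (V := (M : ℝ)) (Nat.cast_nonneg _) hd0
    simpa only [mul_assoc] using h
  -- the off-diagonal: the HIGH count
  have hKN : 2 ^ K ≤ N := by rw [hN]; exact Nat.pow_le_pow_right (by norm_num) hKj
  have hN' : N + N ≤ 2 * N := by omega
  have hdL' : (((d : ℤ).natAbs : ℕ) : ℝ) ≤ L := by simpa using hdL
  have hA₁ := sum_Ioo_norm_localisedCoeff_le A hA hKq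
  have hoff := typeII_count_high σ K F hF hc0 (κ := walshL1Exponent) (B := 16)
    walshL1Exponent_pos.le walshL1Exponent_lt_half.le (by norm_num) hη0 hA₁ hcη
    (fun a J hJ1 hJ => sum_Ico_norm_localisedCoeff_le_sixteen K σ K₁ A a hJ1 hJ)
    (M := (M : ℝ)) (Nat.cast_nonneg _) hKN (N₀ := N) (N' := N) hN' hd0 hdL' hD₀
  rw [← dyBlock_eq_Ico_add] at hoff
  -- assemble
  have hdnat : (d : ℤ).natAbs = d := Int.natAbs_natCast d
  calc ∑ b ∈ dyBlock j, |∑ a ∈ dyBlock i, localisedWalshRe K σ K₁ A (a * (b + d * 2 ^ K)) *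
          localisedWalshRe K σ K₁ A (a * b)|
      ≤ ∑ b ∈ dyBlock j, (∑ k ∈ Ioo (-(F : ℤ)) F, c k * c k * geomBound M (((k * d : ℤ) : ℝ) / 2 ^ σ) +
          ∑ k ∈ Ioo (-(F : ℤ)) F, ∑ k' ∈ (Ioo (-(F : ℤ)) F).erase k,
            c k * c k' * geomBound M ((((k' - k) * b + k' * d * 2 ^ K : ℤ) : ℝ) / 2 ^ (K + σ))) := by
        refine Finset.sum_le_sum fun b _ => ?_
        rw [← hsplit b, ← hswap b]
        exact hexp b
    _ = ∑ b ∈ dyBlock j, ∑ k ∈ Ioo (-(F : ℤ)) F, c k * c k * geomBound M (((k * d : ℤ) : ℝ) / 2 ^ σ) +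
        ∑ b ∈ dyBlock j, ∑ k ∈ Ioo (-(F : ℤ)) F, ∑ k' ∈ (Ioo (-(F : ℤ)) F).erase k,
            c k * c k' * geomBound M ((((k' - k) * b + k' * d * 2 ^ K : ℤ) : ℝ) / 2 ^ (K + σ)) :=
        Finset.sum_add_distrib
    _ ≤ ∑ _b ∈ dyBlock j, η ^ 2 * ((2 * (F : ℝ)) / 2 ^ σ + 2) *
          (2 ^ ((d : ℤ).natAbs.factorization 2 + 1) * (M : ℝ) + 2 ^ σ * (1 + Real.log (2 ^ σ))) + _ :=
        add_le_add (Finset.sum_le_sum fun b _ => hdiag) hoff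
    _ = _ := by
        rw [Finset.sum_const, card_dyBlock, nsmul_eq_mul, hdnat, hM, hN]
        push_cast
        ring

/-! ### Step 5: the algebra of the regime terms -/

set_option maxHeartbeats 8000000 in
/-- **The regime terms of `typeII_count_high` under the parameters of the shifted-window box
estimate** (`P = M 2^{2ρ+3}`, `F = 2^{2ρ+1}P`, `Q = RP`, `M ≤ RL`, `RL ≤ N`, `L = 2^ρ`,
`A₁ = 4(K+2)P^κ`, `B = 16`, sup `η ≤ 2`): the diagonal and `(K+σ)(T_A + T_{B1} + T_{B2})` are at
most `MN (K+σ+2)³ λ 2^{6ρ+25} (M^{-(1-2κ)} + D₀^{-(1-2κ)} + η D₀²)`.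
[cite: Bourgain2013MoebiusWalsh, §2 (2.28)] -/
theorem count_high_algebra {κ M N R L P Q F A₁ η D₀ lam Kr Kσ V2 : ℝ} {ρ : ℕ}
    (hκ0 : 0 < κ) (hκ : κ < 1 / 2) (hρ : 1 ≤ ρ) (hL : L = (2 : ℝ) ^ ρ)
    (hM1 : 1 ≤ M) (hMN : M ≤ N) (hR0 : 0 < R) (hMRL : M ≤ R * L) (hRLN : R * L ≤ N)
    (hP : P = M * (2 : ℝ) ^ (2 * ρ + 3)) (hQ : Q = R * P) (hFP : F = (2 : ℝ) ^ (2 * ρ + 1) * P)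
    (hKr : 0 ≤ Kr) (hKσr : Kr ≤ Kσ) (hKσ1 : 1 ≤ Kσ) (hA₁ : A₁ = 4 * (Kr + 2) * P ^ κ)
    (hlam : 1 ≤ lam) (hlamP : 1 + Real.log P ≤ lam) (hD₀ : 1 ≤ D₀) (hη0 : 0 ≤ η) (hη2 : η ≤ 2)
    (hV2 : 0 ≤ V2) (hV2L : V2 ≤ 2 * L) :
    N * (η ^ 2 * ((2 * F) / P + 2) * (V2 * M + P * (1 + Real.log P))) +
      Kσ * (A₁ ^ 2 * ((16 * F * N / Q + 1) * (2 * M) + 24 * N * lam) +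
        (136 * (16 : ℝ) ^ 2 * (2 * (F * L / P) + 3) * M * (Q / (16 * N)) ^ (2 * κ) * (N / R) ^ κ +
            68 * (16 : ℝ) ^ 2 * (2 * (F * L / P) + 3) * Q * lam * D₀ ^ (2 * κ - 1) * (N / R) ^ κ +
            8 * 16 * N * A₁ * (Q / (16 * N)) ^ κ +
            16 * (16 : ℝ) ^ 2 * N * Kσ * (2 * (F * L / P) + 3) * P ^ κ * (Q / (16 * N)) ^ (1 - κ) *
              D₀ ^ (2 * κ - 1)) +
        (144 * 16 * (2 * (F * L / P) + 3) * η * M * D₀ ^ (1 + κ) * N / R +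
            72 * 16 * (2 * (F * L / P) + 3) * η * lam * D₀ ^ κ * Q * N / R +
            8 * 16 * D₀ ^ κ * N * η * (2 * F / P + 2) * (2 * L * M + P * lam))) ≤
      M * N * ((Kσ + 2) ^ 3 * lam * (2 : ℝ) ^ (6 * ρ + 25) *
        (M ^ (-(1 - 2 * κ)) + D₀ ^ (-(1 - 2 * κ)) + η * D₀ ^ 2)) := by
  -- positivity and the basic relations
  have hM0 : 0 < M := by linarith
  have hN0 : 0 < N := by linarith
  have hL2 : 2 ≤ L := by
    rw [hL]
    calc (2 : ℝ) = 2 ^ 1 := (pow_one _).symm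
      _ ≤ 2 ^ ρ := pow_le_pow_right₀ one_le_two hρ
  have hL0 : 0 < L := by linarith
  have hP0 : 0 < P := by rw [hP]; positivity
  have hQ0 : 0 < Q := by rw [hQ]; positivity
  have hD0 : 0 < D₀ := by linarith
  have h12κ : 0 < 1 - 2 * κ := by linarith
  have hF0 : 0 ≤ F := by rw [hFP]; positivity
  have hRN : R ≤ N := by
    calc R = R * 1 := (mul_one R).symm
      _ ≤ R * L := mul_le_mul_of_nonneg_left (by linarith) hR0.le
      _ ≤ N := hRLN
  have hNR1 : 1 ≤ N / R := by rw [le_div_iff₀ hR0]; linarith only [hRN]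
  have hRinv : 1 / R ≤ L / M := by
    rw [div_le_div_iff₀ hR0 hM0]; linarith only [hMRL]
  -- `F/P`, `Z₁`, `Z₂`, `Q/(16N)`
  have hFP' : F / P = (2 : ℝ) ^ (2 * ρ + 1) := by rw [hFP]; field_simp
  have hZ₁ : 2 * (F * L / P) + 3 ≤ (2 : ℝ) ^ (3 * ρ + 3) := by
    have e : F * L / P = (2 : ℝ) ^ (2 * ρ + 1) * L := by rw [mul_div_right_comm, hFP']
    rw [e, hL, ← pow_add]
    have h1 : 2 * (2 : ℝ) ^ (2 * ρ + 1 + ρ) = 2 ^ (3 * ρ + 2) := by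
      rw [show 3 * ρ + 2 = (2 * ρ + 1 + ρ) + 1 by ring, pow_succ]; ring
    have h2 : (2 : ℝ) ^ (3 * ρ + 3) = 2 ^ (3 * ρ + 2) + 2 ^ (3 * ρ + 2) := by
      rw [show 3 * ρ + 3 = (3 * ρ + 2) + 1 by ring, pow_succ]; ring
    have h3 : (3 : ℝ) ≤ 2 ^ (3 * ρ + 2) := by
      calc (3 : ℝ) ≤ 2 ^ 2 := by norm_num
        _ ≤ 2 ^ (3 * ρ + 2) := pow_le_pow_right₀ one_le_two (by omega)
    linarith only [h1, h2, h3]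
  have hZ₂ : 2 * F / P + 2 ≤ (2 : ℝ) ^ (2 * ρ + 3) := by
    rw [mul_div_assoc, hFP']
    have h1 : 2 * (2 : ℝ) ^ (2 * ρ + 1) = 2 ^ (2 * ρ + 2) := by rw [pow_succ]; ring
    have h2 : (2 : ℝ) ^ (2 * ρ + 3) = 2 ^ (2 * ρ + 2) + 2 ^ (2 * ρ + 2) := by
      rw [show 2 * ρ + 3 = (2 * ρ + 2) + 1 by ring, pow_succ]; ring
    have h3 : (2 : ℝ) ≤ 2 ^ (2 * ρ + 2) := by
      calc (2 : ℝ) = 2 ^ 1 := (pow_one _).symm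
        _ ≤ 2 ^ (2 * ρ + 2) := pow_le_pow_right₀ one_le_two (by omega)
    linarith only [h1, h2, h3]
  have hq16 : Q / (16 * N) ≤ M * (2 : ℝ) ^ (ρ - 1) := by
    rw [div_le_iff₀ (by positivity), hQ, hP]
    have h1 : R * (M * 2 ^ (2 * ρ + 3)) = (R * L) * M * (2 ^ (2 * ρ + 3) / L) := by
      field_simp
    have h2 : (2 : ℝ) ^ (2 * ρ + 3) / L = 2 ^ (ρ + 3) := by
      rw [hL, div_eq_iff (by positivity), ← pow_add]; ring_nf
    rw [h1, h2]
    have h3 : M * (2 : ℝ) ^ (ρ - 1) * (16 * N) = N * M * 2 ^ (ρ + 3) := by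
      have : (2 : ℝ) ^ (ρ + 3) = 2 ^ (ρ - 1) * 16 := by
        rw [show ρ + 3 = (ρ - 1) + 4 by omega, pow_add]; norm_num
      rw [this]; ring
    rw [h3]
    have h4 := mul_le_mul_of_nonneg_right (mul_le_mul_of_nonneg_right hRLN hM0.le)
      (by positivity : (0 : ℝ) ≤ 2 ^ (ρ + 3))
    linarith only [h4]
  have hq16pos : 0 < Q / (16 * N) := by positivity
  -- abbreviations
  set S₁ : ℝ := M ^ (-(1 - 2 * κ)) with hS₁
  set S₂ : ℝ := D₀ ^ (-(1 - 2 * κ)) with hS₂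
  set S₃ : ℝ := η * D₀ ^ 2 with hS₃
  set W : ℝ := (Kσ + 2) ^ 3 * lam with hW
  set Z₁ : ℝ := 2 * (F * L / P) + 3 with hZ₁def
  set Z₂ : ℝ := 2 * F / P + 2 with hZ₂def
  set q : ℝ := Q / (16 * N) with hq
  set nr : ℝ := N / R with hnr
  have hS₁0 : 0 < S₁ := by positivity
  have hS₂0 : 0 < S₂ := by positivity
  have hS₃0 : 0 ≤ S₃ := by positivity
  have hZ₁0 : 0 ≤ Z₁ := by rw [hZ₁def]; positivity
  have hZ₂0 : 0 ≤ Z₂ := by rw [hZ₂def]; positivity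
  have hq0 : 0 ≤ q := hq16pos.le
  have hnr0 : 0 ≤ nr := by positivity
  have hKσ0 : 0 ≤ Kσ := by linarith
  have hlam0 : 0 ≤ lam := by linarith
  have hK21 : (1 : ℝ) ≤ Kσ + 2 := by linarith
  have hW1 : lam ≤ W := by
    rw [hW]
    have : (1 : ℝ) ≤ (Kσ + 2) ^ 3 := one_le_pow₀ hK21
    calc lam = 1 * lam := (one_mul _).symm
      _ ≤ (Kσ + 2) ^ 3 * lam := mul_le_mul_of_nonneg_right this hlam0
  have hWK : Kσ * (Kσ + 2) ^ 2 * lam ≤ W := by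
    rw [hW]
    have h1 : Kσ * (Kσ + 2) ^ 2 ≤ (Kσ + 2) ^ 3 := by
      rw [pow_succ (Kσ + 2) 2, mul_comm ((Kσ + 2) ^ 2)]
      exact mul_le_mul_of_nonneg_right (by linarith) (sq_nonneg _)
    exact mul_le_mul_of_nonneg_right h1 hlam0
  have hK2sq : Kσ + 2 ≤ (Kσ + 2) ^ 2 := le_self_pow₀ hK21 two_ne_zero
  have hWK1 : Kσ * (Kσ + 2) * lam ≤ W := by
    have h1 : Kσ * (Kσ + 2) ≤ Kσ * (Kσ + 2) ^ 2 := mul_le_mul_of_nonneg_left hK2sq hKσ0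
    exact (mul_le_mul_of_nonneg_right h1 hlam0).trans hWK
  have hWK0 : Kσ * lam ≤ W := by
    have h1 : Kσ ≤ Kσ * (Kσ + 2) := by
      calc Kσ = Kσ * 1 := (mul_one _).symm
        _ ≤ Kσ * (Kσ + 2) := mul_le_mul_of_nonneg_left hK21 hKσ0
    exact (mul_le_mul_of_nonneg_right h1 hlam0).trans hWK1
  have hWK2 : Kσ * Kσ * lam ≤ W := by
    have h1 : Kσ * Kσ ≤ Kσ * (Kσ + 2) := mul_le_mul_of_nonneg_left (by linarith) hKσ0
    exact (mul_le_mul_of_nonneg_right h1 hlam0).trans hWK1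
  have hWK0' : Kσ ≤ W := by
    have : Kσ ≤ Kσ * lam := le_mul_of_one_le_right hKσ0 hlam
    exact this.trans hWK0
  -- powers: `P^κ`, `P^{2κ}`, `q^{·}`, `nr^κ`
  have h2ρ3 : (1 : ℝ) ≤ 2 ^ (2 * ρ + 3) := one_le_pow₀ one_le_two
  have hPκ : P ^ κ ≤ M ^ κ * 2 ^ (2 * ρ + 3) := by
    rw [hP, Real.mul_rpow hM0.le (by positivity)]
    refine mul_le_mul_of_nonneg_left ?_ (by positivity)
    calc ((2 : ℝ) ^ (2 * ρ + 3)) ^ κ ≤ ((2 : ℝ) ^ (2 * ρ + 3)) ^ (1 : ℝ) :=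
          Real.rpow_le_rpow_of_exponent_le h2ρ3 (by linarith)
      _ = 2 ^ (2 * ρ + 3) := Real.rpow_one _
  have hP2κ : P ^ (2 * κ) ≤ M ^ (2 * κ) * 2 ^ (2 * ρ + 3) := by
    rw [hP, Real.mul_rpow hM0.le (by positivity)]
    refine mul_le_mul_of_nonneg_left ?_ (by positivity)
    calc ((2 : ℝ) ^ (2 * ρ + 3)) ^ (2 * κ) ≤ ((2 : ℝ) ^ (2 * ρ + 3)) ^ (1 : ℝ) :=
          Real.rpow_le_rpow_of_exponent_le h2ρ3 (by linarith)
      _ = 2 ^ (2 * ρ + 3) := Real.rpow_one _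
  have h2ρ1 : (1 : ℝ) ≤ 2 ^ (ρ - 1) := one_le_pow₀ one_le_two
  have hqpow : ∀ {e : ℝ}, 0 ≤ e → e ≤ 1 → q ^ e ≤ M ^ e * 2 ^ (ρ - 1) := by
    intro e he0 he1
    calc q ^ e ≤ (M * 2 ^ (ρ - 1)) ^ e := Real.rpow_le_rpow hq0 hq16 he0
      _ = M ^ e * ((2 : ℝ) ^ (ρ - 1)) ^ e := Real.mul_rpow hM0.le (by positivity)
      _ ≤ M ^ e * 2 ^ (ρ - 1) := by
          refine mul_le_mul_of_nonneg_left ?_ (by positivity)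
          calc ((2 : ℝ) ^ (ρ - 1)) ^ e ≤ ((2 : ℝ) ^ (ρ - 1)) ^ (1 : ℝ) :=
                Real.rpow_le_rpow_of_exponent_le h2ρ1 he1
            _ = 2 ^ (ρ - 1) := Real.rpow_one _
  have hnr_le : nr ≤ N * L / M := by
    rw [hnr, div_le_div_iff₀ hR0 hM0]
    calc N * M ≤ N * (R * L) := mul_le_mul_of_nonneg_left hMRL hN0.le
      _ = N * L * R := by ring
  have hLκ : L ^ κ ≤ L := by
    calc L ^ κ ≤ L ^ (1 : ℝ) := Real.rpow_le_rpow_of_exponent_le (by linarith) (by linarith)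
      _ = L := Real.rpow_one _
  have hnrκ : nr ^ κ ≤ N ^ κ * L * M ^ (-κ) := by
    calc nr ^ κ ≤ (N * L / M) ^ κ := Real.rpow_le_rpow hnr0 hnr_le hκ0.le
      _ = N ^ κ * L ^ κ * M ^ (-κ) := by
          rw [div_eq_mul_inv, Real.mul_rpow (by positivity) (by positivity),
            Real.mul_rpow hN0.le hL0.le, Real.inv_rpow hM0.le, Real.rpow_neg hM0.le]
      _ ≤ N ^ κ * L * M ^ (-κ) := by gcongr
  have hnrκ' : nr ^ κ ≤ nr := by
    calc nr ^ κ ≤ nr ^ (1 : ℝ) := Real.rpow_le_rpow_of_exponent_le hNR1 (by linarith)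
      _ = nr := Real.rpow_one _
  -- monomial identities
  have hM2κ : M ^ (2 * κ) = M * S₁ := by
    rw [hS₁, ← Real.rpow_one_add' hM0.le (by linarith)]
    congr 1; ring
  have hMκκ : M ^ κ * M ^ κ = M * S₁ := by
    rw [← Real.rpow_add hM0, ← hM2κ]; ring_nf
  have hNκ : N ^ κ ≤ N * M ^ (κ - 1) := by
    have h1 : N ^ κ = N * N ^ (κ - 1) := by
      rw [← Real.rpow_one_add' hN0.le (by linarith)]; congr 1; ring
    rw [h1]
    exact mul_le_mul_of_nonneg_left (Real.rpow_le_rpow_of_nonpos hM0 hMN (by linarith)) hN0.le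
  have hMκNκ : M * M ^ κ * N ^ κ ≤ M * N * S₁ := by
    have e2 : M ^ κ * M ^ (κ - 1) = S₁ := by
      rw [hS₁, ← Real.rpow_add hM0]; congr 1; ring
    calc M * M ^ κ * N ^ κ ≤ M * M ^ κ * (N * M ^ (κ - 1)) :=
          mul_le_mul_of_nonneg_left hNκ (by positivity)
      _ = M * N * (M ^ κ * M ^ (κ - 1)) := by ring
      _ = M * N * S₁ := by rw [e2]
  have hMκM1κ : M ^ κ * M ^ (1 - κ) = M := by
    rw [← Real.rpow_add hM0]; norm_num
  have hD2κ : D₀ ^ (2 * κ - 1) = S₂ := by rw [hS₂]; congr 1; ring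
  have hD1κ : D₀ ^ (1 + κ) ≤ D₀ ^ 2 := by
    calc D₀ ^ (1 + κ) ≤ D₀ ^ ((2 : ℕ) : ℝ) := Real.rpow_le_rpow_of_exponent_le hD₀ (by push_cast; linarith)
      _ = D₀ ^ 2 := Real.rpow_natCast _ _
  have hDκ : D₀ ^ κ ≤ D₀ ^ 2 := by
    calc D₀ ^ κ ≤ D₀ ^ ((2 : ℕ) : ℝ) := Real.rpow_le_rpow_of_exponent_le hD₀ (by push_cast; linarith)
      _ = D₀ ^ 2 := Real.rpow_natCast _ _
  -- powers of two in `ρ`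
  have hLpow : L * (2 : ℝ) ^ (ρ - 1) ≤ 2 ^ (2 * ρ) := by
    rw [hL, ← pow_add]; exact pow_le_pow_right₀ one_le_two (by omega)
  have hL2ρ : 2 * L = (2 : ℝ) ^ (ρ + 1) := by rw [hL, pow_succ]; ring
  have hL2ρ3 : 2 * L ≤ (2 : ℝ) ^ (2 * ρ + 3) := by
    rw [hL2ρ]; exact pow_le_pow_right₀ one_le_two (by omega)
  have h2LP : 2 * L * M + P * lam ≤ M * lam * 2 ^ (2 * ρ + 4) := by
    rw [hP]
    have h1 : 2 * L * M ≤ 2 ^ (2 * ρ + 3) * M * lam := by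
      have : 2 * L * M ≤ 2 ^ (2 * ρ + 3) * M := mul_le_mul_of_nonneg_right hL2ρ3 hM0.le
      have h2 : (2 : ℝ) ^ (2 * ρ + 3) * M ≤ 2 ^ (2 * ρ + 3) * M * lam :=
        le_mul_of_one_le_right (by positivity) hlam
      linarith
    have e : M * lam * (2 : ℝ) ^ (2 * ρ + 4) = 2 ^ (2 * ρ + 3) * M * lam + M * 2 ^ (2 * ρ + 3) * lam := by
      rw [show 2 * ρ + 4 = (2 * ρ + 3) + 1 by ring, pow_succ]; ring
    linarith
  ------------------------------------------------------------------
  -- the ten terms, each `≤ M N W 2^{6ρ+21} · Sᵢ`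
  ------------------------------------------------------------------
  set G : ℝ := (2 : ℝ) ^ (6 * ρ + 21) with hG
  have hGge : ∀ {m : ℕ}, m ≤ 6 * ρ + 21 → (2 : ℝ) ^ m ≤ G := fun hm =>
    pow_le_pow_right₀ one_le_two hm
  have hMN0 : 0 < M * N := by positivity
  have hW0 : 0 < W := by rw [hW]; positivity
  -- DIAG
  have tD : N * (η ^ 2 * Z₂ * (V2 * M + P * (1 + Real.log P))) ≤ M * N * W * G * S₃ := by
    have h1 : V2 * M + P * (1 + Real.log P) ≤ 2 * L * M + P * lam := by
      have g1 := mul_le_mul_of_nonneg_right hV2L hM0.le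
      have g2 := mul_le_mul_of_nonneg_left hlamP hP0.le
      linarith only [g1, g2]
    have h2 : η ^ 2 ≤ 2 * η := by
      rw [sq]; exact mul_le_mul_of_nonneg_right hη2 hη0
    have hG' : (2 : ℝ) ^ (2 * ρ + 3) * 2 ^ (2 * ρ + 4) * 2 ≤ G := by
      rw [← pow_add, ← pow_succ]; exact hGge (by omega)
    have hD2 : (1 : ℝ) ≤ D₀ ^ 2 := one_le_pow₀ hD₀
    have hlogP : 0 ≤ 1 + Real.log P := by
      have hP1 : (1 : ℝ) ≤ P := by
        rw [hP]
        calc (1 : ℝ) ≤ M := hM1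
          _ ≤ M * 2 ^ (2 * ρ + 3) := le_mul_of_one_le_right hM0.le h2ρ3
      have := Real.log_nonneg hP1
      linarith
    calc N * (η ^ 2 * Z₂ * (V2 * M + P * (1 + Real.log P)))
        ≤ N * ((2 * η) * 2 ^ (2 * ρ + 3) * (M * lam * 2 ^ (2 * ρ + 4))) := by
          refine mul_le_mul_of_nonneg_left ?_ hN0.le
          exact mul_le_mul (mul_le_mul h2 hZ₂ hZ₂0 (by positivity)) (h1.trans h2LP)
            (add_nonneg (by positivity) (mul_nonneg hP0.le hlogP)) (by positivity)
      _ = M * N * lam * ((2 : ℝ) ^ (2 * ρ + 3) * 2 ^ (2 * ρ + 4) * 2) * (η * 1) := by ring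
      _ ≤ M * N * W * G * (η * D₀ ^ 2) := by gcongr
      _ = M * N * W * G * S₃ := by rw [hS₃]
  -- T_A
  have tA : Kσ * (A₁ ^ 2 * ((16 * F * N / Q + 1) * (2 * M) + 24 * N * lam)) ≤ M * N * W * G * S₁ := by
    have h1 : 16 * F * N / Q + 1 ≤ 2 ^ (2 * ρ + 5) * (N * L / M) + 1 := by
      have e : 16 * F * N / Q = 16 * (F / P) * nr := by rw [hQ, hnr]; field_simp
      rw [e, hFP']
      have g := mul_le_mul_of_nonneg_left hnr_le (by positivity : (0 : ℝ) ≤ 16 * (2 : ℝ) ^ (2 * ρ + 1))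
      have e2 : 16 * (2 : ℝ) ^ (2 * ρ + 1) = 2 ^ (2 * ρ + 5) := by
        rw [show 2 * ρ + 5 = (2 * ρ + 1) + 4 by ring, pow_add]; ring
      rw [← e2]
      linarith only [g]
    have h2 : (16 * F * N / Q + 1) * (2 * M) + 24 * N * lam ≤ N * L * lam * 2 ^ (2 * ρ + 8) := by
      have h3 : (16 * F * N / Q + 1) * (2 * M) ≤ (2 ^ (2 * ρ + 5) * (N * L / M) + 1) * (2 * M) :=
        mul_le_mul_of_nonneg_right h1 (by positivity)
      have e : ((2 : ℝ) ^ (2 * ρ + 5) * (N * L / M) + 1) * (2 * M) = 2 ^ (2 * ρ + 6) * (N * L) + 2 * M := by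
        field_simp; ring
      have gNL : N * L ≤ N * L * lam := le_mul_of_one_le_right (by positivity) hlam
      have h4 : 2 * M ≤ 2 * (N * L * lam) := by
        have g1 : M ≤ N * L := by
          calc M ≤ R * L := hMRL
            _ ≤ N * L := mul_le_mul_of_nonneg_right hRN hL0.le
        linarith only [g1, gNL]
      have h5 : (2 : ℝ) ^ (2 * ρ + 6) * (N * L) ≤ 2 ^ (2 * ρ + 6) * (N * L * lam) :=
        mul_le_mul_of_nonneg_left gNL (by positivity)
      have h6 : 24 * N * lam ≤ 24 * (N * L * lam) := by
        have g1 : N * lam ≤ N * lam * L := le_mul_of_one_le_right (by positivity) (by linarith)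
        linarith only [g1]
      have e2 : N * L * lam * (2 : ℝ) ^ (2 * ρ + 8) = (2 ^ (2 * ρ + 6) + 2 ^ (2 * ρ + 6) + 2 ^ (2 * ρ + 7)) * (N * L * lam) := by
        rw [show 2 * ρ + 8 = (2 * ρ + 6) + 2 by ring, show 2 * ρ + 7 = (2 * ρ + 6) + 1 by ring, pow_add, pow_succ]
        ring
      have h7 : (26 : ℝ) ≤ 2 ^ (2 * ρ + 6) + 2 ^ (2 * ρ + 7) := by
        have g1 : (64 : ℝ) ≤ 2 ^ (2 * ρ + 6) := by
          calc (64 : ℝ) = 2 ^ 6 := by norm_num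
            _ ≤ 2 ^ (2 * ρ + 6) := pow_le_pow_right₀ one_le_two (by omega)
        have g2 : (0 : ℝ) ≤ 2 ^ (2 * ρ + 7) := by positivity
        linarith only [g1, g2]
      have hNL0 : 0 ≤ N * L * lam := by positivity
      have h8 := mul_le_mul_of_nonneg_right h7 hNL0
      linarith only [h3, e, h4, h5, h6, e2, h8]
    have h3 : A₁ ^ 2 ≤ 16 * (Kσ + 2) ^ 2 * (M * S₁) * 2 ^ (2 * ρ + 3) := by
      rw [hA₁, mul_pow, mul_pow, ← Real.rpow_natCast (P ^ κ) 2, ← Real.rpow_mul hP0.le]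
      push_cast
      rw [show κ * 2 = 2 * κ by ring, ← hM2κ]
      have g1 : (Kr + 2) ^ 2 ≤ (Kσ + 2) ^ 2 := pow_le_pow_left₀ (by linarith) (by linarith) 2
      have g2 := mul_le_mul g1 hP2κ (by positivity) (by positivity)
      calc (4 : ℝ) ^ 2 * (Kr + 2) ^ 2 * P ^ (2 * κ) = 16 * ((Kr + 2) ^ 2 * P ^ (2 * κ)) := by norm_num; ring
        _ ≤ 16 * ((Kσ + 2) ^ 2 * (M ^ (2 * κ) * 2 ^ (2 * ρ + 3))) := by linarith only [g2]
        _ = 16 * (Kσ + 2) ^ 2 * M ^ (2 * κ) * 2 ^ (2 * ρ + 3) := by ring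
    have hG' : (2 : ℝ) ^ (2 * ρ + 3) * 2 ^ (2 * ρ + 8) * L * 16 ≤ G := by
      rw [hL, ← pow_add, ← pow_add, show (16 : ℝ) = 2 ^ 4 by norm_num, ← pow_add]
      exact hGge (by omega)
    calc Kσ * (A₁ ^ 2 * ((16 * F * N / Q + 1) * (2 * M) + 24 * N * lam))
        ≤ Kσ * ((16 * (Kσ + 2) ^ 2 * (M * S₁) * 2 ^ (2 * ρ + 3)) * (N * L * lam * 2 ^ (2 * ρ + 8))) := by
          refine mul_le_mul_of_nonneg_left ?_ hKσ0
          exact mul_le_mul h3 h2 (by positivity) (by positivity)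
      _ = M * N * (Kσ * (Kσ + 2) ^ 2 * lam) * ((2 : ℝ) ^ (2 * ρ + 3) * 2 ^ (2 * ρ + 8) * L * 16) * S₁ := by ring
      _ ≤ M * N * W * G * S₁ := by gcongr
  -- T_B1 (i)
  have tB1a : Kσ * (136 * (16 : ℝ) ^ 2 * Z₁ * M * q ^ (2 * κ) * nr ^ κ) ≤ M * N * W * G * S₁ := by
    have h1 : M * q ^ (2 * κ) * nr ^ κ ≤ M * N * S₁ * (2 ^ (ρ - 1) * L) := by
      have hq2 := hqpow (e := 2 * κ) (by linarith) (by linarith)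
      have e1 : M ^ (2 * κ) * M ^ (-κ) = M ^ κ := by rw [← Real.rpow_add hM0]; ring_nf
      calc M * q ^ (2 * κ) * nr ^ κ ≤ M * (M ^ (2 * κ) * 2 ^ (ρ - 1)) * (N ^ κ * L * M ^ (-κ)) := by
            gcongr
        _ = (M * (M ^ (2 * κ) * M ^ (-κ)) * N ^ κ) * (2 ^ (ρ - 1) * L) := by ring
        _ = (M * M ^ κ * N ^ κ) * (2 ^ (ρ - 1) * L) := by rw [e1]
        _ ≤ (M * N * S₁) * (2 ^ (ρ - 1) * L) := mul_le_mul_of_nonneg_right hMκNκ (by positivity)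
    have hG' : 136 * (16 : ℝ) ^ 2 * 2 ^ (3 * ρ + 3) * (2 ^ (ρ - 1) * L) ≤ G := by
      have e : (2 : ℝ) ^ (ρ - 1) * L = 2 ^ (2 * ρ - 1) := by
        rw [hL, ← pow_add]; congr 1; omega
      rw [e]
      calc 136 * (16 : ℝ) ^ 2 * 2 ^ (3 * ρ + 3) * 2 ^ (2 * ρ - 1) ≤ 2 ^ 16 * 2 ^ (3 * ρ + 3) * 2 ^ (2 * ρ - 1) := by
            gcongr; norm_num
        _ = 2 ^ (16 + (3 * ρ + 3) + (2 * ρ - 1)) := by ring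
        _ ≤ G := hGge (by omega)
    calc Kσ * (136 * (16 : ℝ) ^ 2 * Z₁ * M * q ^ (2 * κ) * nr ^ κ)
        = Kσ * (136 * (16 : ℝ) ^ 2 * Z₁) * (M * q ^ (2 * κ) * nr ^ κ) := by ring
      _ ≤ W * (136 * (16 : ℝ) ^ 2 * 2 ^ (3 * ρ + 3)) * (M * N * S₁ * (2 ^ (ρ - 1) * L)) := by
          gcongr
      _ = M * N * W * (136 * (16 : ℝ) ^ 2 * 2 ^ (3 * ρ + 3) * (2 ^ (ρ - 1) * L)) * S₁ := by ring
      _ ≤ M * N * W * G * S₁ := by gcongr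
  -- T_B1 (ii)
  have tB1b : Kσ * (68 * (16 : ℝ) ^ 2 * Z₁ * Q * lam * D₀ ^ (2 * κ - 1) * nr ^ κ) ≤ M * N * W * G * S₂ := by
    have h1 : Q * nr ^ κ ≤ P * N := by
      calc Q * nr ^ κ ≤ Q * nr := mul_le_mul_of_nonneg_left hnrκ' hQ0.le
        _ = P * N := by rw [hQ, hnr]; field_simp
    have hG' : 68 * (16 : ℝ) ^ 2 * 2 ^ (3 * ρ + 3) * 2 ^ (2 * ρ + 3) ≤ G := by
      calc 68 * (16 : ℝ) ^ 2 * 2 ^ (3 * ρ + 3) * 2 ^ (2 * ρ + 3) ≤ 2 ^ 15 * 2 ^ (3 * ρ + 3) * 2 ^ (2 * ρ + 3) := by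
            gcongr; norm_num
        _ = 2 ^ (15 + (3 * ρ + 3) + (2 * ρ + 3)) := by ring
        _ ≤ G := hGge (by omega)
    calc Kσ * (68 * (16 : ℝ) ^ 2 * Z₁ * Q * lam * D₀ ^ (2 * κ - 1) * nr ^ κ)
        = (Kσ * lam) * (68 * (16 : ℝ) ^ 2 * Z₁) * (Q * nr ^ κ) * S₂ := by rw [hD2κ]; ring
      _ ≤ W * (68 * (16 : ℝ) ^ 2 * 2 ^ (3 * ρ + 3)) * (P * N) * S₂ := by gcongr
      _ = M * N * W * (68 * (16 : ℝ) ^ 2 * 2 ^ (3 * ρ + 3) * 2 ^ (2 * ρ + 3)) * S₂ := by rw [hP]; ring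
      _ ≤ M * N * W * G * S₂ := by gcongr
  -- T_B1 (iii)
  have tB1c : Kσ * (8 * 16 * N * A₁ * q ^ κ) ≤ M * N * W * G * S₁ := by
    have hq1 := hqpow (e := κ) hκ0.le (by linarith)
    have h1 : A₁ * q ^ κ ≤ 4 * (Kσ + 2) * (M * S₁) * (2 ^ (2 * ρ + 3) * 2 ^ (ρ - 1)) := by
      rw [hA₁]
      calc 4 * (Kr + 2) * P ^ κ * q ^ κ ≤ 4 * (Kσ + 2) * (M ^ κ * 2 ^ (2 * ρ + 3)) * (M ^ κ * 2 ^ (ρ - 1)) := by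
            gcongr
        _ = 4 * (Kσ + 2) * (M ^ κ * M ^ κ) * (2 ^ (2 * ρ + 3) * 2 ^ (ρ - 1)) := by ring
        _ = 4 * (Kσ + 2) * (M * S₁) * (2 ^ (2 * ρ + 3) * 2 ^ (ρ - 1)) := by rw [hMκκ]
    have hG' : 8 * 16 * 4 * ((2 : ℝ) ^ (2 * ρ + 3) * 2 ^ (ρ - 1)) ≤ G := by
      rw [← pow_add, show (8 * 16 * 4 : ℝ) = 2 ^ 9 by norm_num, ← pow_add]
      exact hGge (by omega)
    calc Kσ * (8 * 16 * N * A₁ * q ^ κ) = Kσ * (8 * 16) * N * (A₁ * q ^ κ) := by ring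
      _ ≤ Kσ * (8 * 16) * N * (4 * (Kσ + 2) * (M * S₁) * (2 ^ (2 * ρ + 3) * 2 ^ (ρ - 1))) := by gcongr
      _ = M * N * (Kσ * (Kσ + 2) * 1) * (8 * 16 * 4 * ((2 : ℝ) ^ (2 * ρ + 3) * 2 ^ (ρ - 1))) * S₁ := by ring
      _ ≤ M * N * W * G * S₁ := by
          gcongr
          calc Kσ * (Kσ + 2) * 1 ≤ Kσ * (Kσ + 2) * lam := by gcongr
            _ ≤ W := hWK1
  -- T_B1 (iv)
  have tB1d : Kσ * (16 * (16 : ℝ) ^ 2 * N * Kσ * Z₁ * P ^ κ * q ^ (1 - κ) * D₀ ^ (2 * κ - 1)) ≤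
      M * N * W * G * S₂ := by
    have hq1 := hqpow (e := 1 - κ) (by linarith) (by linarith)
    have h1 : P ^ κ * q ^ (1 - κ) ≤ M * (2 ^ (2 * ρ + 3) * 2 ^ (ρ - 1)) := by
      calc P ^ κ * q ^ (1 - κ) ≤ (M ^ κ * 2 ^ (2 * ρ + 3)) * (M ^ (1 - κ) * 2 ^ (ρ - 1)) := by gcongr
        _ = (M ^ κ * M ^ (1 - κ)) * (2 ^ (2 * ρ + 3) * 2 ^ (ρ - 1)) := by ring
        _ = M * (2 ^ (2 * ρ + 3) * 2 ^ (ρ - 1)) := by rw [hMκM1κ]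
    have hG' : 16 * (16 : ℝ) ^ 2 * 2 ^ (3 * ρ + 3) * (2 ^ (2 * ρ + 3) * 2 ^ (ρ - 1)) ≤ G := by
      rw [← pow_add, show (16 * (16 : ℝ) ^ 2) = 2 ^ 12 by norm_num, ← pow_add, ← pow_add]
      exact hGge (by omega)
    calc Kσ * (16 * (16 : ℝ) ^ 2 * N * Kσ * Z₁ * P ^ κ * q ^ (1 - κ) * D₀ ^ (2 * κ - 1))
        = (Kσ * Kσ) * (16 * (16 : ℝ) ^ 2) * N * Z₁ * (P ^ κ * q ^ (1 - κ)) * S₂ := by rw [hD2κ]; ring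
      _ ≤ (Kσ * Kσ) * (16 * (16 : ℝ) ^ 2) * N * 2 ^ (3 * ρ + 3) * (M * (2 ^ (2 * ρ + 3) * 2 ^ (ρ - 1))) * S₂ := by
          gcongr
      _ = M * N * (Kσ * Kσ * 1) * (16 * (16 : ℝ) ^ 2 * 2 ^ (3 * ρ + 3) * (2 ^ (2 * ρ + 3) * 2 ^ (ρ - 1))) * S₂ := by
          ring
      _ ≤ M * N * W * G * S₂ := by
          gcongr
          calc Kσ * Kσ * 1 ≤ Kσ * Kσ * lam := by gcongr
            _ ≤ W := hWK2
  -- T_B2 (i)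
  have tB2a : Kσ * (144 * 16 * Z₁ * η * M * D₀ ^ (1 + κ) * N / R) ≤ M * N * W * G * S₃ := by
    have h1 : M * D₀ ^ (1 + κ) * N / R ≤ N * L * D₀ ^ 2 := by
      have e : M * D₀ ^ (1 + κ) * N / R = D₀ ^ (1 + κ) * (M / R) * N := by field_simp
      rw [e]
      have h2 : M / R ≤ L := by rw [div_le_iff₀ hR0]; linarith
      calc D₀ ^ (1 + κ) * (M / R) * N ≤ D₀ ^ 2 * L * N := by gcongr
        _ = N * L * D₀ ^ 2 := by ring
    have hG' : 144 * 16 * (2 : ℝ) ^ (3 * ρ + 3) * L ≤ G := by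
      rw [hL]
      calc 144 * 16 * (2 : ℝ) ^ (3 * ρ + 3) * 2 ^ ρ ≤ 2 ^ 12 * 2 ^ (3 * ρ + 3) * 2 ^ ρ := by gcongr; norm_num
        _ = 2 ^ (12 + (3 * ρ + 3) + ρ) := by ring
        _ ≤ G := hGge (by omega)
    calc Kσ * (144 * 16 * Z₁ * η * M * D₀ ^ (1 + κ) * N / R)
        = Kσ * (144 * 16 * Z₁) * η * (M * D₀ ^ (1 + κ) * N / R) := by ring
      _ ≤ W * (144 * 16 * 2 ^ (3 * ρ + 3)) * η * (N * L * D₀ ^ 2) := by gcongr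
      _ = N * W * (144 * 16 * (2 : ℝ) ^ (3 * ρ + 3) * L) * S₃ := by rw [hS₃]; ring
      _ ≤ (M * N) * W * G * S₃ := by
          gcongr
          exact le_mul_of_one_le_left hN0.le hM1
  -- T_B2 (ii)
  have tB2b : Kσ * (72 * 16 * Z₁ * η * lam * D₀ ^ κ * Q * N / R) ≤ M * N * W * G * S₃ := by
    have e : Q * N / R = P * N := by rw [hQ]; field_simp
    have hG' : 72 * 16 * (2 : ℝ) ^ (3 * ρ + 3) * 2 ^ (2 * ρ + 3) ≤ G := by
      calc 72 * 16 * (2 : ℝ) ^ (3 * ρ + 3) * 2 ^ (2 * ρ + 3) ≤ 2 ^ 11 * 2 ^ (3 * ρ + 3) * 2 ^ (2 * ρ + 3) := by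
            gcongr; norm_num
        _ = 2 ^ (11 + (3 * ρ + 3) + (2 * ρ + 3)) := by ring
        _ ≤ G := hGge (by omega)
    calc Kσ * (72 * 16 * Z₁ * η * lam * D₀ ^ κ * Q * N / R)
        = (Kσ * lam) * (72 * 16 * Z₁) * (η * D₀ ^ κ) * (Q * N / R) := by ring
      _ ≤ W * (72 * 16 * 2 ^ (3 * ρ + 3)) * (η * D₀ ^ 2) * (P * N) := by rw [e]; gcongr
      _ = M * N * W * (72 * 16 * (2 : ℝ) ^ (3 * ρ + 3) * 2 ^ (2 * ρ + 3)) * S₃ := by rw [hS₃, hP]; ring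
      _ ≤ M * N * W * G * S₃ := by gcongr
  -- T_B2 (iii)
  have tB2c : Kσ * (8 * 16 * D₀ ^ κ * N * η * Z₂ * (2 * L * M + P * lam)) ≤ M * N * W * G * S₃ := by
    have hG' : 8 * 16 * (2 : ℝ) ^ (2 * ρ + 3) * 2 ^ (2 * ρ + 4) ≤ G := by
      rw [show (8 * 16 : ℝ) = 2 ^ 7 by norm_num, ← pow_add, ← pow_add]
      exact hGge (by omega)
    calc Kσ * (8 * 16 * D₀ ^ κ * N * η * Z₂ * (2 * L * M + P * lam))
        = Kσ * (8 * 16) * N * (η * D₀ ^ κ) * Z₂ * (2 * L * M + P * lam) := by ring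
      _ ≤ Kσ * (8 * 16) * N * (η * D₀ ^ 2) * 2 ^ (2 * ρ + 3) * (M * lam * 2 ^ (2 * ρ + 4)) := by gcongr
      _ = M * N * (Kσ * lam) * (8 * 16 * (2 : ℝ) ^ (2 * ρ + 3) * 2 ^ (2 * ρ + 4)) * S₃ := by rw [hS₃]; ring
      _ ≤ M * N * W * G * S₃ := by gcongr
  -- sum
  have hsum : N * (η ^ 2 * Z₂ * (V2 * M + P * (1 + Real.log P))) +
      Kσ * (A₁ ^ 2 * ((16 * F * N / Q + 1) * (2 * M) + 24 * N * lam) +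
        (136 * (16 : ℝ) ^ 2 * Z₁ * M * q ^ (2 * κ) * nr ^ κ +
            68 * (16 : ℝ) ^ 2 * Z₁ * Q * lam * D₀ ^ (2 * κ - 1) * nr ^ κ +
            8 * 16 * N * A₁ * q ^ κ +
            16 * (16 : ℝ) ^ 2 * N * Kσ * Z₁ * P ^ κ * q ^ (1 - κ) * D₀ ^ (2 * κ - 1)) +
        (144 * 16 * Z₁ * η * M * D₀ ^ (1 + κ) * N / R +
            72 * 16 * Z₁ * η * lam * D₀ ^ κ * Q * N / R +
            8 * 16 * D₀ ^ κ * N * η * Z₂ * (2 * L * M + P * lam))) ≤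
      M * N * W * G * (3 * S₁ + 2 * S₂ + 4 * S₃) := by
    have e : Kσ * (A₁ ^ 2 * ((16 * F * N / Q + 1) * (2 * M) + 24 * N * lam) +
        (136 * (16 : ℝ) ^ 2 * Z₁ * M * q ^ (2 * κ) * nr ^ κ +
            68 * (16 : ℝ) ^ 2 * Z₁ * Q * lam * D₀ ^ (2 * κ - 1) * nr ^ κ +
            8 * 16 * N * A₁ * q ^ κ +
            16 * (16 : ℝ) ^ 2 * N * Kσ * Z₁ * P ^ κ * q ^ (1 - κ) * D₀ ^ (2 * κ - 1)) +
        (144 * 16 * Z₁ * η * M * D₀ ^ (1 + κ) * N / R +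
            72 * 16 * Z₁ * η * lam * D₀ ^ κ * Q * N / R +
            8 * 16 * D₀ ^ κ * N * η * Z₂ * (2 * L * M + P * lam))) =
        Kσ * (A₁ ^ 2 * ((16 * F * N / Q + 1) * (2 * M) + 24 * N * lam)) +
        (Kσ * (136 * (16 : ℝ) ^ 2 * Z₁ * M * q ^ (2 * κ) * nr ^ κ) +
          Kσ * (68 * (16 : ℝ) ^ 2 * Z₁ * Q * lam * D₀ ^ (2 * κ - 1) * nr ^ κ) +
          Kσ * (8 * 16 * N * A₁ * q ^ κ) +
          Kσ * (16 * (16 : ℝ) ^ 2 * N * Kσ * Z₁ * P ^ κ * q ^ (1 - κ) * D₀ ^ (2 * κ - 1))) +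
        (Kσ * (144 * 16 * Z₁ * η * M * D₀ ^ (1 + κ) * N / R) +
          Kσ * (72 * 16 * Z₁ * η * lam * D₀ ^ κ * Q * N / R) +
          Kσ * (8 * 16 * D₀ ^ κ * N * η * Z₂ * (2 * L * M + P * lam))) := by ring
    rw [e]
    have e2 : M * N * W * G * (3 * S₁ + 2 * S₂ + 4 * S₃) =
        M * N * W * G * S₃ + (M * N * W * G * S₁ + (M * N * W * G * S₁ + M * N * W * G * S₂ +
          M * N * W * G * S₁ + M * N * W * G * S₂) + (M * N * W * G * S₃ + M * N * W * G * S₃ +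
            M * N * W * G * S₃)) := by ring
    rw [e2]
    exact add_le_add tD (add_le_add (add_le_add tA (add_le_add (add_le_add (add_le_add tB1a tB1b) tB1c) tB1d))
      (add_le_add (add_le_add tB2a tB2b) tB2c))
  refine hsum.trans ?_
  have hG16 : G * 4 ≤ (2 : ℝ) ^ (6 * ρ + 25) := by
    rw [hG, show (4 : ℝ) = 2 ^ 2 by norm_num, ← pow_add]
    exact pow_le_pow_right₀ one_le_two (by omega)
  have h3 : 3 * S₁ + 2 * S₂ + 4 * S₃ ≤ 4 * (S₁ + S₂ + S₃) := by linarith only [hS₁0.le, hS₂0.le]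
  calc M * N * W * G * (3 * S₁ + 2 * S₂ + 4 * S₃) ≤ M * N * W * G * (4 * (S₁ + S₂ + S₃)) := by gcongr
    _ = M * N * (W * (G * 4) * (S₁ + S₂ + S₃)) := by ring
    _ ≤ M * N * (W * (2 : ℝ) ^ (6 * ρ + 25) * (S₁ + S₂ + S₃)) := by gcongr
    _ = _ := by rw [hW, hS₁, hS₂, hS₃]


/-! ### Step 6: the per-box estimate for the shifted window -/

/-- `2^{κσ} = (2^σ)^κ`. [folklore] -/
theorem two_rpow_mul_natCast (κ : ℝ) (σ : ℕ) : (2 : ℝ) ^ (κ * σ) = ((2 : ℝ) ^ σ) ^ κ := by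
  rw [← Real.rpow_natCast 2 σ, ← Real.rpow_mul (by norm_num), mul_comm]

set_option maxHeartbeats 4000000 in
/-- **All lags: the localised differenced sums are small** (Steps 4–5 summed over `1 ≤ d < 2^ρ`).
With `σ = i + 2ρ + 3`, `K₁ = 2^{2ρ}`, digits of `A` in `[K, K+σ)`, `1 ≤ ρ`, `i ≤ K + ρ`, `4ρ < K`,
`K + ρ ≤ j`, `D₀ ≥ 1`:
`∑_{1 ≤ d < 2^ρ} ∑_{b ∈ D_j} |∑_{a ∈ D_i} W(a(b+d2^K)) W(ab)| ≤ (2^ρ - 1) · 2^i 2^j (K+σ+2)³ λ 2^{6ρ+25} (2^{-(1-2κ)i} + D₀^{-(1-2κ)} + η D₀²)`,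
`λ = 1 + log 2^{K+σ}`, `η = 2·2^{-c₂|A|}`. [cite: Bourgain2013MoebiusWalsh, §2 (2.11)–(2.28)] -/
theorem sum_localised_le (i j ρ K σ K₁ : ℕ) (hσ : σ = i + 2 * ρ + 3) (hK₁ : K₁ = 2 ^ (2 * ρ))
    (hρ : 1 ≤ ρ) (hiK : i ≤ K + ρ) (hK4 : 4 * ρ < K) (hKj : K + ρ ≤ j)
    (A : Finset (Fin (K + σ))) (hA : ∀ j' ∈ A, K ≤ (j' : ℕ)) {D₀ : ℕ} (hD₀ : 1 ≤ D₀) :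
    ∑ d ∈ Ico 1 (2 ^ ρ), ∑ b ∈ dyBlock j,
        |∑ a ∈ dyBlock i, localisedWalshRe K σ K₁ A (a * (b + d * 2 ^ K)) *
          localisedWalshRe K σ K₁ A (a * b)| ≤
      ((2 ^ ρ - 1 : ℕ) : ℝ) * ((2 : ℝ) ^ i * 2 ^ j *
        ((((K + σ : ℕ) : ℝ) + 2) ^ 3 * (1 + Real.log ((2 : ℝ) ^ (K + σ))) *
          (2 : ℝ) ^ (6 * ρ + 25) *
          (((2 : ℝ) ^ i) ^ (-(1 - 2 * walshL1Exponent)) + (D₀ : ℝ) ^ (-(1 - 2 * walshL1Exponent)) +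
            (2 * (2 : ℝ) ^ (-(walshSupExponent * A.card))) * (D₀ : ℝ) ^ 2))) := by
  have hK₁2 : 2 ≤ K₁ := by
    rw [hK₁]
    calc 2 = 2 ^ 1 := (pow_one 2).symm
      _ ≤ 2 ^ (2 * ρ) := Nat.pow_le_pow_right (by norm_num) (by omega)
  have hKq : 4 * K₁ ≤ 2 ^ K := by
    rw [hK₁, show 4 * 2 ^ (2 * ρ) = 2 ^ (2 * ρ + 2) by rw [pow_add]; ring]
    exact Nat.pow_le_pow_right (by norm_num) (by omega)
  have hF : 4 * (2 * (K₁ * 2 ^ σ)) ≤ 2 ^ (K + σ) := by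
    rw [hK₁, show 4 * (2 * (2 ^ (2 * ρ) * 2 ^ σ)) = 2 ^ ((2 * ρ + 3) + σ) by rw [pow_add, pow_add]; ring]
    exact Nat.pow_le_pow_right (by norm_num) (by omega)
  have hKj' : K ≤ j := by omega
  have e2j : ((2 ^ j : ℕ) : ℝ) = (2 : ℝ) ^ j := by push_cast; ring
  -- the `d`-independent bound
  set BND : ℝ := (2 : ℝ) ^ i * 2 ^ j *
    ((((K + σ : ℕ) : ℝ) + 2) ^ 3 * (1 + Real.log ((2 : ℝ) ^ (K + σ))) * (2 : ℝ) ^ (6 * ρ + 25) *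
      (((2 : ℝ) ^ i) ^ (-(1 - 2 * walshL1Exponent)) + (D₀ : ℝ) ^ (-(1 - 2 * walshL1Exponent)) +
        (2 * (2 : ℝ) ^ (-(walshSupExponent * A.card))) * (D₀ : ℝ) ^ 2)) with hBND
  have hterm : ∀ d ∈ Ico 1 (2 ^ ρ), ∑ b ∈ dyBlock j,
      |∑ a ∈ dyBlock i, localisedWalshRe K σ K₁ A (a * (b + d * 2 ^ K)) * localisedWalshRe K σ K₁ A (a * b)| ≤
      BND := by
    intro d hd
    have hv : d.factorization 2 < ρ := factorization_two_lt_of_mem_Ico hd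
    rw [Finset.mem_Ico] at hd
    have hdL : (d : ℝ) ≤ (2 : ℝ) ^ ρ := by exact_mod_cast hd.2.le
    have hcount := sum_abs_localised_le_count K σ K₁ A hA hKq hF i j hKj' hd.1 hdL hD₀
    refine hcount.trans ?_
    -- the algebra
    have halg := count_high_algebra (κ := walshL1Exponent) (M := (2 : ℝ) ^ i) (N := ((2 ^ j : ℕ) : ℝ))
      (R := (2 : ℝ) ^ K) (L := (2 : ℝ) ^ ρ) (P := (2 : ℝ) ^ σ) (Q := (2 : ℝ) ^ (K + σ))
      (F := ((2 * (K₁ * 2 ^ σ) : ℕ) : ℝ)) (A₁ := 4 * ((K : ℝ) + 2) * (2 : ℝ) ^ (walshL1Exponent * σ))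
      (η := 2 * (2 : ℝ) ^ (-(walshSupExponent * A.card))) (D₀ := (D₀ : ℝ))
      (lam := 1 + Real.log ((2 : ℝ) ^ (K + σ))) (Kr := (K : ℝ)) (Kσ := ((K + σ : ℕ) : ℝ))
      (V2 := (2 : ℝ) ^ (d.factorization 2 + 1)) (ρ := ρ)
      walshL1Exponent_pos walshL1Exponent_lt_half hρ rfl
      (one_le_pow₀ one_le_two)
      (by rw [e2j]; exact pow_le_pow_right₀ one_le_two (by omega))
      (by positivity)
      (by rw [← pow_add]; exact pow_le_pow_right₀ one_le_two hiK)
      (by rw [e2j, ← pow_add]; exact pow_le_pow_right₀ one_le_two hKj)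
      (by rw [hσ]; ring)
      (by rw [pow_add])
      (by rw [hK₁]; push_cast; ring)
      (Nat.cast_nonneg K)
      (by push_cast; linarith)
      (by have : (1 : ℝ) ≤ K := by exact_mod_cast (show 1 ≤ K by omega)
          push_cast; linarith)
      (by rw [two_rpow_mul_natCast])
      (by have := Real.log_nonneg (one_le_pow₀ (M₀ := ℝ) one_le_two (n := K + σ)); linarith)
      (by have : (2 : ℝ) ^ σ ≤ 2 ^ (K + σ) := pow_le_pow_right₀ one_le_two (by omega)
          have := Real.log_le_log (by positivity) this
          linarith)
      (by exact_mod_cast hD₀)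
      (by positivity)
      (by have : (2 : ℝ) ^ (-(walshSupExponent * (A.card : ℝ))) ≤ 1 :=
            Real.rpow_le_one_of_one_le_of_nonpos one_le_two (by
              have := walshSupExponent_pos
              have : (0 : ℝ) ≤ A.card := Nat.cast_nonneg _
              nlinarith)
          linarith)
      (by positivity)
      (by rw [show 2 * (2 : ℝ) ^ ρ = 2 ^ (ρ + 1) by rw [pow_succ]; ring]
          exact pow_le_pow_right₀ one_le_two (by omega))
    rw [hBND, ← e2j]
    exact halg
  calc ∑ d ∈ Ico 1 (2 ^ ρ), ∑ b ∈ dyBlock j,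
        |∑ a ∈ dyBlock i, localisedWalshRe K σ K₁ A (a * (b + d * 2 ^ K)) * localisedWalshRe K σ K₁ A (a * b)|
      ≤ ∑ _d ∈ Ico 1 (2 ^ ρ), BND := Finset.sum_le_sum hterm
    _ = ((2 ^ ρ - 1 : ℕ) : ℝ) * BND := by rw [Finset.sum_const, Nat.card_Ico, nsmul_eq_mul]

/-- Commuting a double count: `∑_{b} #{a : p a b} = ∑_{a} #{b : p a b}`. [folklore] -/
theorem sum_card_filter_comm (s t : Finset ℕ) (p : ℕ → ℕ → Prop) [DecidableRel p] :
    ∑ b ∈ t, ((s.filter fun a => p a b).card : ℝ) = ∑ a ∈ s, ((t.filter fun b => p a b).card : ℝ) := by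
  simp only [Finset.card_filter]
  push_cast
  exact Finset.sum_comm

set_option maxHeartbeats 4000000 in
/-- **The shifted-window type-II box estimate, squared** (Bourgain 2013, §2 for `K ≥ μ - ρ`,
assembled): for `1 ≤ ρ`, `i ≤ K + ρ`, `4ρ < K`, `K + ρ ≤ j`, `|β| ≤ 1`, `D₀ ≥ 1`, with
`σ = i + 2ρ + 3`, `w = |T ∩ [K, K+σ)|`, `Y = 2^{i+j+3}`,
`(∑_{a ∈ D_i} |∑_{b ∈ D_j} β(b) w_T(ab)|)² ≤ (2^i 2^j)² Φ`,
`Φ = 28·2^{-ρ} + 256 (1 + log Y)² 2^{-ρ/2} + 4 (K+σ+2)³ (1 + log 2^{K+σ}) 2^{6ρ+25} (2^{-(1-2κ)i} + D₀^{-(1-2κ)} + 2·2^{-c₂w} D₀²)`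
(Steps 1–5: van der Corput with lags `d2^K`, carry truncation, Lemma 5, the divisor second moment,
the pair count of `typeII_count_high` and the diagonal). [cite: Bourgain2013MoebiusWalsh, §2 (2.1)–(2.12), (2.23)–(2.29)] -/
theorem sq_sum_abs_le_high (T : Finset ℕ) {i j ρ K : ℕ} (hρ : 1 ≤ ρ) (hiK : i ≤ K + ρ)
    (hK4 : 4 * ρ < K) (hKj : K + ρ ≤ j) {β : ℕ → ℝ} (hβ : ∀ b, |β b| ≤ 1) {D₀ : ℕ} (hD₀ : 1 ≤ D₀) :
    (∑ a ∈ dyBlock i, |∑ b ∈ dyBlock j, β b * natWalsh T (a * b)|) ^ 2 ≤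
      ((2 : ℝ) ^ i * 2 ^ j) ^ 2 *
        (28 * (2 : ℝ) ^ (-(ρ : ℝ)) +
          256 * (1 + Real.log ((2 : ℝ) ^ (i + j + 3))) ^ 2 * (2 : ℝ) ^ (-(ρ : ℝ) / 2) +
          4 * ((((K + (i + 2 * ρ + 3) : ℕ) : ℝ) + 2) ^ 3 * (1 + Real.log ((2 : ℝ) ^ (K + (i + 2 * ρ + 3)))) *
            (2 : ℝ) ^ (6 * ρ + 25) *
            (((2 : ℝ) ^ i) ^ (-(1 - 2 * walshL1Exponent)) + (D₀ : ℝ) ^ (-(1 - 2 * walshL1Exponent)) +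
              (2 * (2 : ℝ) ^ (-(walshSupExponent *
                ((T.filter fun t => K ≤ t ∧ t < (K + i + ρ + 1) + (ρ + 2)).card : ℝ)))) * (D₀ : ℝ) ^ 2))) := by
  classical
  -- parameters
  have hσ : (K + i + ρ + 1) + (ρ + 2) = K + (i + 2 * ρ + 3) := by ring
  set σ : ℕ := i + 2 * ρ + 3 with hσdef
  set K₁ : ℕ := 2 ^ (2 * ρ) with hK₁
  set L : ℕ := 2 ^ ρ with hL
  set T' : Finset ℕ := T.filter fun t => K ≤ t ∧ t < (K + i + ρ + 1) + (ρ + 2) with hT'def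
  have hT' : ∀ x ∈ T', x < K + σ := by
    intro x hx; rw [hT'def, Finset.mem_filter] at hx; omega
  set A : Finset (Fin (K + σ)) := T'.attachFin hT' with hAdef
  have hA : ∀ j' ∈ A, K ≤ (j' : ℕ) := by
    intro j' hj'
    rw [hAdef, Finset.mem_attachFin, hT'def, Finset.mem_filter] at hj'
    exact hj'.2.1
  have hcardA : A.card = T'.card := by rw [hAdef, Finset.card_attachFin]
  have hK₁2 : 2 ≤ K₁ := by
    rw [hK₁]
    calc 2 = 2 ^ 1 := (pow_one 2).symm
      _ ≤ 2 ^ (2 * ρ) := Nat.pow_le_pow_right (by norm_num) (by omega)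
  have hKq : 4 * K₁ ≤ 2 ^ K := by
    rw [hK₁, show 4 * 2 ^ (2 * ρ) = 2 ^ (2 * ρ + 2) by rw [pow_add]; ring]
    exact Nat.pow_le_pow_right (by norm_num) (by omega)
  have hL1 : 1 ≤ L := Nat.one_le_two_pow
  have hLK : (L - 1) * 2 ^ K ≤ 2 ^ j := by
    calc (L - 1) * 2 ^ K ≤ L * 2 ^ K := Nat.mul_le_mul_right _ (Nat.sub_le _ _)
      _ = 2 ^ (ρ + K) := by rw [hL, pow_add]
      _ ≤ 2 ^ j := Nat.pow_le_pow_right (by norm_num) (by omega)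
  set M : ℝ := (2 : ℝ) ^ i with hM
  set N : ℝ := (2 : ℝ) ^ j with hN
  have hM0 : 0 < M := by positivity
  have hN0 : 0 < N := by positivity
  have hLr : (L : ℝ) = (2 : ℝ) ^ ρ := by rw [hL]; push_cast; ring
  have hL0 : (0 : ℝ) < L := by rw [hLr]; positivity
  -- Step 1
  have h1 := sq_sum_abs_le_vdC T i j K hL1 hLK hβ
  -- Step 2
  have h2 : ∑ d ∈ Ico 1 L, ∑ b ∈ dyBlock j,
      |∑ a ∈ dyBlock i, natWalsh T (a * (b + d * 2 ^ K)) * natWalsh T (a * b)| ≤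
      ∑ d ∈ Ico 1 L, ∑ b ∈ dyBlock j,
        |∑ a ∈ dyBlock i, natWalsh T' (a * (b + d * 2 ^ K)) * natWalsh T' (a * b)| +
      ∑ d ∈ Ico 1 L, ∑ b ∈ dyBlock j,
        2 * (((dyBlock i).filter fun a => (a * b / 2 ^ (K + i + ρ + 1)) % 2 ^ (ρ + 2) = 2 ^ (ρ + 2) - 1).card : ℝ) := by
    rw [← Finset.sum_add_distrib]
    refine Finset.sum_le_sum fun d hd => ?_
    rw [← Finset.sum_add_distrib]
    refine Finset.sum_le_sum fun b _ => ?_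
    rw [Finset.mem_Ico] at hd
    exact abs_sum_mul_le_window_add_carry T i K ρ (ρ + 2) b (d := d) (by rw [hL] at hd; exact hd.2)
  -- the carry count
  have h3 : ∑ d ∈ Ico 1 L, ∑ b ∈ dyBlock j,
      2 * (((dyBlock i).filter fun a => (a * b / 2 ^ (K + i + ρ + 1)) % 2 ^ (ρ + 2) = 2 ^ (ρ + 2) - 1).card : ℝ) ≤
      6 * M * N := by
    have hcomm := sum_card_filter_comm (dyBlock i) (dyBlock j)
      (fun a b => (a * b / 2 ^ (K + i + ρ + 1)) % 2 ^ (ρ + 2) = 2 ^ (ρ + 2) - 1)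
    have hcarry := sum_card_carry_le i j K ρ hρ hK4 hKj
    have hinner : ∑ b ∈ dyBlock j,
        2 * (((dyBlock i).filter fun a => (a * b / 2 ^ (K + i + ρ + 1)) % 2 ^ (ρ + 2) = 2 ^ (ρ + 2) - 1).card : ℝ) ≤
        6 * M * N / 2 ^ ρ := by
      rw [← Finset.mul_sum, hcomm]
      have := mul_le_mul_of_nonneg_left hcarry (by norm_num : (0 : ℝ) ≤ 2)
      refine this.trans (le_of_eq ?_)
      rw [hM, hN]; ring
    calc ∑ d ∈ Ico 1 L, ∑ b ∈ dyBlock j,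
          2 * (((dyBlock i).filter fun a => (a * b / 2 ^ (K + i + ρ + 1)) % 2 ^ (ρ + 2) = 2 ^ (ρ + 2) - 1).card : ℝ)
        ≤ ∑ _d ∈ Ico 1 L, 6 * M * N / 2 ^ ρ := Finset.sum_le_sum fun d _ => hinner
      _ = ((L - 1 : ℕ) : ℝ) * (6 * M * N / 2 ^ ρ) := by rw [Finset.sum_const, Nat.card_Ico, nsmul_eq_mul]
      _ ≤ (2 : ℝ) ^ ρ * (6 * M * N / 2 ^ ρ) := by
          refine mul_le_mul_of_nonneg_right ?_ (by positivity)
          rw [← hLr]; exact_mod_cast Nat.sub_le L 1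
      _ = 6 * M * N := by field_simp
  -- Step 3
  have h4 : ∑ d ∈ Ico 1 L, ∑ b ∈ dyBlock j,
      |∑ a ∈ dyBlock i, natWalsh T' (a * (b + d * 2 ^ K)) * natWalsh T' (a * b)| ≤
      ∑ d ∈ Ico 1 L, ∑ b ∈ dyBlock j,
        |∑ a ∈ dyBlock i, localisedWalshRe K σ K₁ A (a * (b + d * 2 ^ K)) * localisedWalshRe K σ K₁ A (a * b)| +
      4 * ((L - 1 : ℕ) : ℝ) *
        (Real.sqrt ((2 ^ (i + j + 3) : ℕ) * (1 + Real.log ((2 ^ (i + j + 3) : ℕ))) ^ 3) *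
          Real.sqrt (((2 ^ (i + j + 3) : ℕ) / (2 : ℝ) ^ (K + σ) + 2) * (2 ^ (K + σ) / (2 * ((K₁ : ℝ) - 1))))) := by
    have e : ∀ x, natWalsh T' x = walshNat A x := fun x =>
      Literature.NumberTheory.LFunctions.MoebiusWalsh.natWalsh_eq_walshNat T' hT' x
    simp only [e]
    exact sum_abs_le_localised_add_error K σ K₁ A hA hK₁2 hKq i j hLK
  -- Step 4–5
  have h5 := sum_localised_le i j ρ K σ K₁ hσdef hK₁ hρ hiK hK4 hKj A hA hD₀
  -- the error term numerics: `4(L-1)√(Y lgY³)√E₂ ≤ 64 L M N lgY² 2^{-ρ/2}`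
  set Y : ℕ := 2 ^ (i + j + 3) with hY
  set lgY : ℝ := 1 + Real.log ((2 : ℝ) ^ (i + j + 3)) with hlgY
  have hYr : (Y : ℝ) = 8 * M * N := by rw [hY, hM, hN]; push_cast; ring
  have hY0 : (0 : ℝ) < Y := by rw [hYr]; positivity
  have hlgY1 : 1 ≤ lgY := by
    have := Real.log_nonneg (one_le_pow₀ (M₀ := ℝ) one_le_two (n := i + j + 3)); rw [hlgY]; linarith
  have hQY : (2 : ℝ) ^ (K + σ) ≤ Y * 2 ^ ρ := by
    rw [hY]; push_cast; rw [← pow_add]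
    exact pow_le_pow_right₀ one_le_two (by omega)
  have hE₂ : (((2 ^ (i + j + 3) : ℕ) : ℝ) / (2 : ℝ) ^ (K + σ) + 2) * (2 ^ (K + σ) / (2 * ((K₁ : ℝ) - 1))) ≤
      3 * Y * (2 : ℝ) ^ (-(ρ : ℝ)) := by
    have hK₁r : (K₁ : ℝ) = (2 : ℝ) ^ (2 * ρ) := by rw [hK₁]; push_cast; ring
    have hK₁1 : (2 : ℝ) ≤ K₁ := by exact_mod_cast hK₁2
    have hden : (K₁ : ℝ) ≤ 2 * ((K₁ : ℝ) - 1) := by linarith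
    have hden0 : (0 : ℝ) < 2 * ((K₁ : ℝ) - 1) := by linarith
    have hQ0 : (0 : ℝ) < 2 ^ (K + σ) := by positivity
    have e1 : (((2 ^ (i + j + 3) : ℕ) : ℝ) / (2 : ℝ) ^ (K + σ) + 2) * (2 ^ (K + σ) / (2 * ((K₁ : ℝ) - 1))) =
        ((Y : ℝ) + 2 * 2 ^ (K + σ)) / (2 * ((K₁ : ℝ) - 1)) := by
      rw [hY]; field_simp
    have e2 : 3 * (Y : ℝ) * (2 : ℝ) ^ (-(ρ : ℝ)) * K₁ = 3 * Y * 2 ^ ρ := by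
      rw [hK₁r, mul_assoc (3 * (Y : ℝ)), ← Real.rpow_natCast 2 (2 * ρ), ← Real.rpow_add two_pos,
        ← Real.rpow_natCast 2 ρ]
      congr 2; push_cast; ring
    have h2 : (Y : ℝ) + 2 * 2 ^ (K + σ) ≤ 3 * Y * 2 ^ ρ := by
      have : (Y : ℝ) ≤ Y * 2 ^ ρ := le_mul_of_one_le_right hY0.le (one_le_pow₀ one_le_two)
      linarith
    rw [e1, div_le_iff₀ hden0]
    calc (Y : ℝ) + 2 * 2 ^ (K + σ) ≤ 3 * Y * 2 ^ ρ := h2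
      _ = 3 * Y * (2 : ℝ) ^ (-(ρ : ℝ)) * K₁ := e2.symm
      _ ≤ 3 * Y * (2 : ℝ) ^ (-(ρ : ℝ)) * (2 * ((K₁ : ℝ) - 1)) := mul_le_mul_of_nonneg_left hden (by positivity)
  have hERR : 4 * ((L - 1 : ℕ) : ℝ) *
      (Real.sqrt ((2 ^ (i + j + 3) : ℕ) * (1 + Real.log ((2 ^ (i + j + 3) : ℕ))) ^ 3) *
        Real.sqrt (((2 ^ (i + j + 3) : ℕ) / (2 : ℝ) ^ (K + σ) + 2) * (2 ^ (K + σ) / (2 * ((K₁ : ℝ) - 1))))) ≤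
      64 * L * M * N * lgY ^ 2 * (2 : ℝ) ^ (-(ρ : ℝ) / 2) := by
    have elog : (1 + Real.log (((2 ^ (i + j + 3) : ℕ) : ℝ))) = lgY := by rw [hlgY]; push_cast; ring
    have eYc : (((2 ^ (i + j + 3) : ℕ) : ℝ)) = Y := by rw [hY]
    rw [elog, eYc]
    -- the product of square roots
    have hprod : Real.sqrt ((Y : ℝ) * lgY ^ 3) *
        Real.sqrt (((Y : ℝ) / (2 : ℝ) ^ (K + σ) + 2) * (2 ^ (K + σ) / (2 * ((K₁ : ℝ) - 1)))) ≤
        2 * Y * lgY ^ 2 * (2 : ℝ) ^ (-(ρ : ℝ) / 2) := by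
      have hb0 : 0 ≤ ((Y : ℝ) / (2 : ℝ) ^ (K + σ) + 2) * (2 ^ (K + σ) / (2 * ((K₁ : ℝ) - 1))) := by
        have hK₁1 : (2 : ℝ) ≤ K₁ := by exact_mod_cast hK₁2
        have : (0 : ℝ) < 2 * ((K₁ : ℝ) - 1) := by linarith
        positivity
      rw [← Real.sqrt_mul (by positivity)]
      have hZ0 : 0 ≤ 2 * (Y : ℝ) * lgY ^ 2 * (2 : ℝ) ^ (-(ρ : ℝ) / 2) := by positivity
      rw [← Real.sqrt_sq hZ0]
      refine Real.sqrt_le_sqrt ?_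
      have e3 : (2 * (Y : ℝ) * lgY ^ 2 * (2 : ℝ) ^ (-(ρ : ℝ) / 2)) ^ 2 = 4 * (Y : ℝ) ^ 2 * lgY ^ 4 * (2 : ℝ) ^ (-(ρ : ℝ)) := by
        have : ((2 : ℝ) ^ (-(ρ : ℝ) / 2)) ^ 2 = (2 : ℝ) ^ (-(ρ : ℝ)) := by
          rw [← Real.rpow_natCast, ← Real.rpow_mul (by norm_num)]; ring_nf
        rw [mul_pow, mul_pow, mul_pow, this]; ring
      rw [e3]
      have hYe : ((Y : ℝ) / (2 : ℝ) ^ (K + σ) + 2) * (2 ^ (K + σ) / (2 * ((K₁ : ℝ) - 1))) ≤ 3 * Y * (2 : ℝ) ^ (-(ρ : ℝ)) := by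
        have := hE₂; rwa [eYc] at this
      calc (Y : ℝ) * lgY ^ 3 * (((Y : ℝ) / (2 : ℝ) ^ (K + σ) + 2) * (2 ^ (K + σ) / (2 * ((K₁ : ℝ) - 1))))
          ≤ (Y : ℝ) * lgY ^ 3 * (3 * Y * (2 : ℝ) ^ (-(ρ : ℝ))) := mul_le_mul_of_nonneg_left hYe (by positivity)
        _ = 3 * (Y : ℝ) ^ 2 * lgY ^ 3 * (2 : ℝ) ^ (-(ρ : ℝ)) := by ring
        _ ≤ 4 * (Y : ℝ) ^ 2 * lgY ^ 4 * (2 : ℝ) ^ (-(ρ : ℝ)) := by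
            have hl3 : lgY ^ 3 ≤ lgY ^ 4 := pow_le_pow_right₀ hlgY1 (by norm_num)
            have hl0 : 0 ≤ lgY ^ 3 := by positivity
            have h0 : 0 ≤ (Y : ℝ) ^ 2 * (2 : ℝ) ^ (-(ρ : ℝ)) := by positivity
            nlinarith [mul_le_mul_of_nonneg_left hl3 h0]
    have hL1' : ((L - 1 : ℕ) : ℝ) ≤ L := by exact_mod_cast Nat.sub_le L 1
    calc 4 * ((L - 1 : ℕ) : ℝ) * (Real.sqrt ((Y : ℝ) * lgY ^ 3) *
          Real.sqrt (((Y : ℝ) / (2 : ℝ) ^ (K + σ) + 2) * (2 ^ (K + σ) / (2 * ((K₁ : ℝ) - 1)))))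
        ≤ 4 * (L : ℝ) * (2 * Y * lgY ^ 2 * (2 : ℝ) ^ (-(ρ : ℝ) / 2)) := by
          refine mul_le_mul (by linarith) hprod (by positivity) (by positivity)
      _ = 64 * L * M * N * lgY ^ 2 * (2 : ℝ) ^ (-(ρ : ℝ) / 2) := by rw [hYr]; ring
  -- assemble
  have hX0 : 0 ≤ ∑ d ∈ Ico 1 L, ∑ b ∈ dyBlock j,
      |∑ a ∈ dyBlock i, natWalsh T (a * (b + d * 2 ^ K)) * natWalsh T (a * b)| :=
    Finset.sum_nonneg fun d _ => Finset.sum_nonneg fun b _ => abs_nonneg _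
  set BND : ℝ := (2 : ℝ) ^ i * 2 ^ j *
    ((((K + σ : ℕ) : ℝ) + 2) ^ 3 * (1 + Real.log ((2 : ℝ) ^ (K + σ))) * (2 : ℝ) ^ (6 * ρ + 25) *
      (((2 : ℝ) ^ i) ^ (-(1 - 2 * walshL1Exponent)) + (D₀ : ℝ) ^ (-(1 - 2 * walshL1Exponent)) +
        (2 * (2 : ℝ) ^ (-(walshSupExponent * A.card))) * (D₀ : ℝ) ^ 2)) with hBND
  have hBND0 : 0 ≤ BND := by
    rw [hBND]
    have : 0 ≤ 1 + Real.log ((2 : ℝ) ^ (K + σ)) := by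
      have := Real.log_nonneg (one_le_pow₀ (M₀ := ℝ) one_le_two (n := K + σ)); linarith
    positivity
  have hXle : ∑ d ∈ Ico 1 L, ∑ b ∈ dyBlock j,
      |∑ a ∈ dyBlock i, natWalsh T (a * (b + d * 2 ^ K)) * natWalsh T (a * b)| ≤
      ((L - 1 : ℕ) : ℝ) * BND + 64 * L * M * N * lgY ^ 2 * (2 : ℝ) ^ (-(ρ : ℝ) / 2) + 6 * M * N := by
    have := h5
    linarith [h2, h3, h4, h5, hERR]
  have hL1' : ((L - 1 : ℕ) : ℝ) ≤ L := by exact_mod_cast Nat.sub_le L 1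
  have hLneg : (2 : ℝ) ^ (-(ρ : ℝ)) = 1 / L := by
    rw [hLr, Real.rpow_neg (by norm_num), Real.rpow_natCast, one_div]
  calc (∑ a ∈ dyBlock i, |∑ b ∈ dyBlock j, β b * natWalsh T (a * b)|) ^ 2
      ≤ (4 * (2 : ℝ) ^ i * 2 ^ j / L) * ((2 : ℝ) ^ i * 2 ^ j + ∑ d ∈ Ico 1 L, ∑ b ∈ dyBlock j,
          |∑ a ∈ dyBlock i, natWalsh T (a * (b + d * 2 ^ K)) * natWalsh T (a * b)|) := h1
    _ ≤ (4 * M * N / L) * (M * N + (((L - 1 : ℕ) : ℝ) * BND + 64 * L * M * N * lgY ^ 2 * (2 : ℝ) ^ (-(ρ : ℝ) / 2) +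
          6 * M * N)) := by
        rw [hM, hN]
        exact mul_le_mul_of_nonneg_left (add_le_add le_rfl hXle) (by positivity)
    _ ≤ (4 * M * N / L) * (7 * (M * N) + 64 * L * M * N * lgY ^ 2 * (2 : ℝ) ^ (-(ρ : ℝ) / 2) + L * BND) := by
        refine mul_le_mul_of_nonneg_left ?_ (by positivity)
        have : ((L - 1 : ℕ) : ℝ) * BND ≤ L * BND := mul_le_mul_of_nonneg_right hL1' hBND0
        linarith
    _ = (M * N) ^ 2 * (28 * (1 / L) + 256 * lgY ^ 2 * (2 : ℝ) ^ (-(ρ : ℝ) / 2)) + 4 * (M * N) * BND := by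
        field_simp
        ring
    _ = (M * N) ^ 2 * (28 * (2 : ℝ) ^ (-(ρ : ℝ)) + 256 * lgY ^ 2 * (2 : ℝ) ^ (-(ρ : ℝ) / 2) +
          4 * ((((K + σ : ℕ) : ℝ) + 2) ^ 3 * (1 + Real.log ((2 : ℝ) ^ (K + σ))) * (2 : ℝ) ^ (6 * ρ + 25) *
            (((2 : ℝ) ^ i) ^ (-(1 - 2 * walshL1Exponent)) + (D₀ : ℝ) ^ (-(1 - 2 * walshL1Exponent)) +
              (2 * (2 : ℝ) ^ (-(walshSupExponent * A.card))) * (D₀ : ℝ) ^ 2))) := by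
        rw [hLneg, hBND, hM, hN]; ring
    _ = _ := by rw [hcardA, hM, hN]

/-! ### Step 7: the three-savings form -/

/-- `√(c² · 2^x · y²) = c 2^{x/2} y` for `c, y ≥ 0`. [folklore] -/
theorem sqrt_sq_mul_two_rpow_mul_sq {c x y : ℝ} (hc : 0 ≤ c) (hy : 0 ≤ y) :
    Real.sqrt (c ^ 2 * (2 : ℝ) ^ x * y ^ 2) = c * (2 : ℝ) ^ (x / 2) * y := by
  rw [Real.sqrt_mul (by positivity), Real.sqrt_mul (by positivity), Real.sqrt_sq hc, Real.sqrt_sq hy,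
    sqrt_two_rpow]

set_option maxHeartbeats 8000000 in
/-- **Bourgain 2013, §2, the type-II estimate for the shifted windows, clean form** — the `K > 0`
half of the per-box hypothesis `hII` of `LiouvilleWalsh.bourgain_liouville_walsh_uniform_of_typeII`:
there are `c > 0`, `C ≥ 1` (explicitly `c = min(1/4, (1-2κ)/2, c₂/2)`, `C = ⌈7/(1-2κ)⌉ + 40`) with
`∑_{a ∈ D_i} |∑_{b ∈ D_j} β(b) w_T(ab)| ≤ (i+j+2)^C 2^{i+j} (2^{-cρ} + 2^{Cρ-ci} + 2^{Cρ - c|T ∩ [K,K+i)|})`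
for all `T`, `i ≤ j`, `1 ≤ ρ`, `i ≤ K + ρ`, `4ρ < K`, `K + ρ ≤ j`, `|β| ≤ 1` (from
`sq_sum_abs_le_high` with `D₀ = 2^{⌈7/(1-2κ)⌉ρ}` and the square root).
[cite: Bourgain2013MoebiusWalsh, §2 (2.23)–(2.29)] -/
theorem typeII_clean_high :
    ∃ c : ℝ, 0 < c ∧ ∃ C : ℝ, 1 ≤ C ∧
      ∀ (T : Finset ℕ) (i j ρ K : ℕ) (β : ℕ → ℝ), i ≤ j → 1 ≤ ρ → i ≤ K + ρ → 4 * ρ < K →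
        K + ρ ≤ j → (∀ b, |β b| ≤ 1) →
        ∑ a ∈ dyBlock i, |∑ b ∈ dyBlock j, β b * natWalsh T (a * b)| ≤
          ((i : ℝ) + j + 2) ^ C * 2 ^ (i + j) *
            ((2 : ℝ) ^ (-(c * ρ)) + (2 : ℝ) ^ (C * ρ - c * i) +
              (2 : ℝ) ^ (C * ρ - c * ((T.filter fun t => K ≤ t ∧ t < K + i).card : ℝ))) := by
  classical
  set κ : ℝ := walshL1Exponent with hκ
  set c₂ : ℝ := walshSupExponent with hc₂
  have hκ0 : 0 < κ := walshL1Exponent_pos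
  have hκh : κ < 1 / 2 := walshL1Exponent_lt_half
  have hc₂0 : 0 < c₂ := walshSupExponent_pos
  set g : ℝ := 1 - 2 * κ with hg
  have hg0 : 0 < g := by rw [hg]; linarith
  set D' : ℕ := ⌈7 / g⌉₊ with hD'
  have hD'g : 7 ≤ g * D' := by
    have h1 : 7 / g ≤ D' := Nat.le_ceil _
    have h2 : 7 / g * g = 7 := by field_simp
    have := mul_le_mul_of_nonneg_right h1 hg0.le
    linarith
  set c : ℝ := min (1 / 4) (min (g / 2) (c₂ / 2)) with hc
  have hc0 : 0 < c := by rw [hc]; exact lt_min (by norm_num) (lt_min (by linarith) (by linarith))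
  have hc4 : c ≤ 1 / 4 := min_le_left _ _
  have hcg : c ≤ g / 2 := (min_le_right _ _).trans (min_le_left _ _)
  have hcc₂ : c ≤ c₂ / 2 := (min_le_right _ _).trans (min_le_right _ _)
  set C : ℝ := (D' : ℝ) + 40 with hC
  have hD'0 : (0 : ℝ) ≤ D' := Nat.cast_nonneg _
  have hC40 : 40 ≤ C := by rw [hC]; linarith
  refine ⟨c, hc0, C, by linarith, ?_⟩
  intro T i j ρ K β hij hρ hiK hK4 hKj hβ
  -- the data
  set D₀ : ℕ := 2 ^ (D' * ρ) with hD₀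
  have hD₀1 : 1 ≤ D₀ := Nat.one_le_two_pow
  have hsq := sq_sum_abs_le_high T hρ hiK hK4 hKj hβ hD₀1
  set σ : ℕ := i + 2 * ρ + 3 with hσ
  set w : ℕ := (T.filter fun t => K ≤ t ∧ t < (K + i + ρ + 1) + (ρ + 2)).card with hw
  set w₀ : ℕ := (T.filter fun t => K ≤ t ∧ t < K + i).card with hw₀
  set MN : ℝ := (2 : ℝ) ^ i * 2 ^ j with hMN
  set lgY : ℝ := 1 + Real.log ((2 : ℝ) ^ (i + j + 3)) with hlgY
  set W : ℝ := (((K + (i + 2 * ρ + 3) : ℕ) : ℝ) + 2) ^ 3 * (1 + Real.log ((2 : ℝ) ^ (K + (i + 2 * ρ + 3)))) with hW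
  set S : ℝ := ∑ a ∈ dyBlock i, |∑ b ∈ dyBlock j, β b * natWalsh T (a * b)| with hS
  have hS0 : 0 ≤ S := Finset.sum_nonneg fun a _ => abs_nonneg _
  have hMN0 : 0 < MN := by positivity
  have hMNeq : MN = 2 ^ (i + j) := by rw [hMN, pow_add]
  -- sizes of the polynomial factors
  have hbase3 : (3 : ℝ) ≤ (i : ℝ) + j + 2 := by
    have : (1 : ℝ) ≤ j := by exact_mod_cast (show 1 ≤ j by omega)
    have : (0 : ℝ) ≤ i := Nat.cast_nonneg _
    linarith
  set P2 : ℝ := (i : ℝ) + j + 2 with hP2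
  have hP2_1 : (1 : ℝ) ≤ P2 := by linarith
  have hlgYle : lgY ≤ 2 * P2 := by
    rw [hlgY, Real.log_pow]
    have h2 : Real.log 2 ≤ 1 := by have := Real.log_two_lt_d9; linarith
    have : ((i + j + 3 : ℕ) : ℝ) * Real.log 2 ≤ (i + j + 3 : ℕ) := by
      have := mul_le_mul_of_nonneg_left h2 (Nat.cast_nonneg (i + j + 3)); simpa using this
    rw [hP2]; push_cast at this ⊢; linarith
  have hlgY1 : 1 ≤ lgY := by
    have := Real.log_nonneg (one_le_pow₀ (M₀ := ℝ) one_le_two (n := i + j + 3)); rw [hlgY]; linarith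
  have hKσ : (((K + (i + 2 * ρ + 3) : ℕ) : ℝ)) + 2 ≤ 3 * P2 := by
    have : K + (i + 2 * ρ + 3) + 2 ≤ 3 * (i + j + 2) := by omega
    have : (((K + (i + 2 * ρ + 3) + 2 : ℕ) : ℝ)) ≤ ((3 * (i + j + 2) : ℕ) : ℝ) := by exact_mod_cast this
    rw [hP2]; push_cast at this ⊢; linarith
  have hlogKσ : 1 + Real.log ((2 : ℝ) ^ (K + (i + 2 * ρ + 3))) ≤ 3 * P2 := by
    rw [Real.log_pow]
    have h2 : Real.log 2 ≤ 1 := by have := Real.log_two_lt_d9; linarith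
    have : ((K + (i + 2 * ρ + 3) : ℕ) : ℝ) * Real.log 2 ≤ (K + (i + 2 * ρ + 3) : ℕ) := by
      have := mul_le_mul_of_nonneg_left h2 (Nat.cast_nonneg (K + (i + 2 * ρ + 3))); simpa using this
    linarith
  have hlogKσ0 : 0 ≤ 1 + Real.log ((2 : ℝ) ^ (K + (i + 2 * ρ + 3))) := by
    have := Real.log_nonneg (one_le_pow₀ (M₀ := ℝ) one_le_two (n := K + (i + 2 * ρ + 3))); linarith
  have hW0 : 0 ≤ W := by rw [hW]; positivity
  have hWle : W ≤ (9 * P2 ^ 2) ^ 2 := by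
    rw [hW]
    have h1 : ((((K + (i + 2 * ρ + 3) : ℕ) : ℝ)) + 2) ^ 3 ≤ (3 * P2) ^ 3 :=
      pow_le_pow_left₀ (by positivity) hKσ 3
    calc ((((K + (i + 2 * ρ + 3) : ℕ) : ℝ)) + 2) ^ 3 * (1 + Real.log ((2 : ℝ) ^ (K + (i + 2 * ρ + 3))))
        ≤ (3 * P2) ^ 3 * (3 * P2) := mul_le_mul h1 hlogKσ hlogKσ0 (by positivity)
      _ = (9 * P2 ^ 2) ^ 2 := by ring
  have hsqrtW : Real.sqrt W ≤ 9 * P2 ^ 2 := by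
    rw [← Real.sqrt_sq (by positivity : (0 : ℝ) ≤ 9 * P2 ^ 2)]
    exact Real.sqrt_le_sqrt hWle
  clear_value W lgY
  -- `S ≤ MN √Φ`
  set Φ : ℝ := 28 * (2 : ℝ) ^ (-(ρ : ℝ)) + 256 * lgY ^ 2 * (2 : ℝ) ^ (-(ρ : ℝ) / 2) +
    4 * (W * (2 : ℝ) ^ (6 * ρ + 25) *
      (((2 : ℝ) ^ i) ^ (-(1 - 2 * walshL1Exponent)) + (D₀ : ℝ) ^ (-(1 - 2 * walshL1Exponent)) +
        (2 * (2 : ℝ) ^ (-(walshSupExponent * (w : ℝ)))) * (D₀ : ℝ) ^ 2)) with hΦ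
  have hΦ0 : 0 ≤ Φ := by rw [hΦ]; positivity
  have hsq' : S ^ 2 ≤ (MN * Real.sqrt Φ) ^ 2 := by
    rw [mul_pow, Real.sq_sqrt hΦ0]
    exact hsq
  have hSle : S ≤ MN * Real.sqrt Φ := (pow_le_pow_iff_left₀ hS0 (by positivity) two_ne_zero).1 hsq'
  -- `√Φ ≤ …`: five terms
  have hD₀r : (D₀ : ℝ) = (2 : ℝ) ^ ((D' : ℝ) * ρ) := by
    rw [hD₀]; push_cast; rw [← Real.rpow_natCast]; push_cast; ring_nf
  have hD₀pos : (0 : ℝ) < D₀ := by exact_mod_cast hD₀1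
  set t1 : ℝ := 28 * (2 : ℝ) ^ (-(ρ : ℝ)) with ht1
  set t2 : ℝ := 256 * lgY ^ 2 * (2 : ℝ) ^ (-(ρ : ℝ) / 2) with ht2
  set t3 : ℝ := 4 * (W * (2 : ℝ) ^ (6 * ρ + 25) * ((2 : ℝ) ^ i) ^ (-(1 - 2 * walshL1Exponent))) with ht3
  set t4 : ℝ := 4 * (W * (2 : ℝ) ^ (6 * ρ + 25) * (D₀ : ℝ) ^ (-(1 - 2 * walshL1Exponent))) with ht4
  set t5 : ℝ := 4 * (W * (2 : ℝ) ^ (6 * ρ + 25) * ((2 * (2 : ℝ) ^ (-(walshSupExponent * (w : ℝ)))) * (D₀ : ℝ) ^ 2)) with ht5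
  have hΦsplit : Φ = t1 + t2 + t3 + t4 + t5 := by rw [hΦ, ht1, ht2, ht3, ht4, ht5]; ring
  have h0t1 : 0 ≤ t1 := by positivity
  have h0t2 : 0 ≤ t2 := by positivity
  have h0t3 : 0 ≤ t3 := by positivity
  have h0t4 : 0 ≤ t4 := by positivity
  have h0t5 : 0 ≤ t5 := by positivity
  have hsqrtΦ : Real.sqrt Φ ≤ Real.sqrt t1 + Real.sqrt t2 + Real.sqrt t3 + Real.sqrt t4 + Real.sqrt t5 := by
    rw [hΦsplit]
    calc Real.sqrt (t1 + t2 + t3 + t4 + t5) ≤ Real.sqrt (t1 + t2 + t3 + t4) + Real.sqrt t5 :=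
          sqrt_add_le_sqrt_add_sqrt'' (by positivity) h0t5
      _ ≤ Real.sqrt (t1 + t2 + t3) + Real.sqrt t4 + Real.sqrt t5 := by
          have := sqrt_add_le_sqrt_add_sqrt'' (by positivity : 0 ≤ t1 + t2 + t3) h0t4; linarith
      _ ≤ Real.sqrt (t1 + t2) + Real.sqrt t3 + Real.sqrt t4 + Real.sqrt t5 := by
          have := sqrt_add_le_sqrt_add_sqrt'' (by positivity : 0 ≤ t1 + t2) h0t3; linarith
      _ ≤ Real.sqrt t1 + Real.sqrt t2 + Real.sqrt t3 + Real.sqrt t4 + Real.sqrt t5 := by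
          have := sqrt_add_le_sqrt_add_sqrt'' h0t1 h0t2; linarith
  -- the key exponent comparisons
  have hρ0 : (0 : ℝ) ≤ ρ := Nat.cast_nonneg _
  have hi0 : (0 : ℝ) ≤ i := Nat.cast_nonneg _
  have hw0' : (0 : ℝ) ≤ w := Nat.cast_nonneg _
  have hcρ4 : c * ρ ≤ 1 / 4 * ρ := mul_le_mul_of_nonneg_right hc4 hρ0
  have e_ρ2 : (2 : ℝ) ^ (-(ρ : ℝ) / 2) ≤ (2 : ℝ) ^ (-(c * ρ)) :=
    Real.rpow_le_rpow_of_exponent_le one_le_two (by linarith only [hcρ4, hρ0])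
  have e_ρ4 : (2 : ℝ) ^ (-(ρ : ℝ) / 2 / 2) ≤ (2 : ℝ) ^ (-(c * ρ)) :=
    Real.rpow_le_rpow_of_exponent_le one_le_two (by linarith only [hcρ4, hρ0])
  -- term 1: `√t1 = √28 · 2^{-ρ/2} ≤ 6 · 2^{-cρ}`
  have hT1 : Real.sqrt t1 ≤ 6 * (2 : ℝ) ^ (-(c * ρ)) := by
    rw [ht1, Real.sqrt_mul (by norm_num), sqrt_two_rpow]
    have h28 : Real.sqrt 28 ≤ 6 := by rw [Real.sqrt_le_left (by norm_num)]; norm_num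
    exact mul_le_mul h28 e_ρ2 (by positivity) (by norm_num)
  -- term 2: `√t2 = 16 lgY 2^{-ρ/4} ≤ 32 P2 · 2^{-cρ}`
  have hT2 : Real.sqrt t2 ≤ 32 * P2 * (2 : ℝ) ^ (-(c * ρ)) := by
    have e : t2 = 16 ^ 2 * (2 : ℝ) ^ (-(ρ : ℝ) / 2) * lgY ^ 2 := by rw [ht2]; ring
    rw [e, sqrt_sq_mul_two_rpow_mul_sq (by norm_num) (by linarith)]
    calc 16 * (2 : ℝ) ^ (-(ρ : ℝ) / 2 / 2) * lgY ≤ 16 * (2 : ℝ) ^ (-(c * ρ)) * (2 * P2) :=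
          mul_le_mul (mul_le_mul_of_nonneg_left e_ρ4 (by norm_num)) hlgYle (by linarith) (by positivity)
      _ = 32 * P2 * (2 : ℝ) ^ (-(c * ρ)) := by ring
  -- the common factor of terms 3–5: `√(4 W 2^{6ρ+25} X) = 2 √W 2^{(6ρ+25)/2} √X`
  have h2pow : (2 : ℝ) ^ (6 * ρ + 25) = (2 : ℝ) ^ ((6 * ρ + 25 : ℕ) : ℝ) := (Real.rpow_natCast _ _).symm
  have hcommon : ∀ X : ℝ, 0 ≤ X → Real.sqrt (4 * (W * (2 : ℝ) ^ (6 * ρ + 25) * X)) =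
      2 * Real.sqrt W * (2 : ℝ) ^ (((6 * ρ + 25 : ℕ) : ℝ) / 2) * Real.sqrt X := by
    intro X hX
    rw [h2pow, show 4 * (W * (2 : ℝ) ^ ((6 * ρ + 25 : ℕ) : ℝ) * X) = (4 * W) * ((2 : ℝ) ^ ((6 * ρ + 25 : ℕ) : ℝ) * X) by ring,
      Real.sqrt_mul (by positivity), Real.sqrt_mul (by positivity), Real.sqrt_mul (by positivity),
      sqrt_two_rpow, show Real.sqrt 4 = 2 by rw [show (4 : ℝ) = 2 ^ 2 by norm_num, Real.sqrt_sq (by norm_num)]]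
    ring
  have hsqW2 : 2 * Real.sqrt W * (2 : ℝ) ^ (((6 * ρ + 25 : ℕ) : ℝ) / 2) ≤ 18 * P2 ^ 2 * (2 : ℝ) ^ (3 * (ρ : ℝ) + 13) := by
    have e1 : (2 : ℝ) ^ (((6 * ρ + 25 : ℕ) : ℝ) / 2) ≤ (2 : ℝ) ^ (3 * (ρ : ℝ) + 13) :=
      Real.rpow_le_rpow_of_exponent_le one_le_two (by push_cast; linarith)
    calc 2 * Real.sqrt W * (2 : ℝ) ^ (((6 * ρ + 25 : ℕ) : ℝ) / 2) ≤ 2 * (9 * P2 ^ 2) * (2 : ℝ) ^ (3 * (ρ : ℝ) + 13) := by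
          gcongr
      _ = 18 * P2 ^ 2 * (2 : ℝ) ^ (3 * (ρ : ℝ) + 13) := by ring
  -- term 3
  have hT3 : Real.sqrt t3 ≤ 18 * P2 ^ 2 * (2 : ℝ) ^ (3 * (ρ : ℝ) + 13) * (2 : ℝ) ^ (-(c * i)) := by
    rw [ht3, hcommon _ (by positivity)]
    have e : Real.sqrt (((2 : ℝ) ^ i) ^ (-(1 - 2 * walshL1Exponent))) ≤ (2 : ℝ) ^ (-(c * i)) := by
      rw [← Real.rpow_natCast 2 i, ← Real.rpow_mul (by norm_num), sqrt_two_rpow]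
      refine Real.rpow_le_rpow_of_exponent_le one_le_two ?_
      rw [← hκ, ← hg]
      have := mul_le_mul_of_nonneg_right hcg hi0
      linarith only [this]
    exact mul_le_mul hsqW2 e (Real.sqrt_nonneg _) (by positivity)
  -- term 4: `D₀^{-g/2} ≤ 2^{-7ρ/2}`
  have hT4 : Real.sqrt t4 ≤ 18 * P2 ^ 2 * (2 : ℝ) ^ (3 * (ρ : ℝ) + 13) * (2 : ℝ) ^ (-(7 * (ρ : ℝ)) / 2) := by
    rw [ht4, hcommon _ (by positivity)]
    have e : Real.sqrt ((D₀ : ℝ) ^ (-(1 - 2 * walshL1Exponent))) ≤ (2 : ℝ) ^ (-(7 * (ρ : ℝ)) / 2) := by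
      rw [hD₀r, ← Real.rpow_mul (by norm_num), sqrt_two_rpow]
      refine Real.rpow_le_rpow_of_exponent_le one_le_two ?_
      rw [← hκ, ← hg]
      have := mul_le_mul_of_nonneg_right hD'g hρ0
      linarith only [this]
    exact mul_le_mul hsqW2 e (Real.sqrt_nonneg _) (by positivity)
  -- term 5: `√(2 · 2^{-c₂ w} D₀²) = √2 2^{-c₂w/2} D₀ ≤ 2 · 2^{-c w} 2^{D'ρ}`
  have hT5 : Real.sqrt t5 ≤ 18 * P2 ^ 2 * (2 : ℝ) ^ (3 * (ρ : ℝ) + 13) *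
      (2 * (2 : ℝ) ^ (-(c * w)) * (2 : ℝ) ^ ((D' : ℝ) * ρ)) := by
    rw [ht5, hcommon _ (by positivity)]
    have e : Real.sqrt ((2 * (2 : ℝ) ^ (-(walshSupExponent * (w : ℝ)))) * (D₀ : ℝ) ^ 2) ≤
        2 * (2 : ℝ) ^ (-(c * w)) * (2 : ℝ) ^ ((D' : ℝ) * ρ) := by
      rw [Real.sqrt_mul (by positivity), Real.sqrt_sq hD₀pos.le, Real.sqrt_mul (by norm_num), sqrt_two_rpow, hD₀r]
      have h2 : Real.sqrt 2 ≤ 2 := by rw [Real.sqrt_le_left (by norm_num)]; norm_num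
      have h3 : (2 : ℝ) ^ (-(walshSupExponent * (w : ℝ)) / 2) ≤ (2 : ℝ) ^ (-(c * w)) := by
        refine Real.rpow_le_rpow_of_exponent_le one_le_two ?_
        rw [← hc₂]
        have := mul_le_mul_of_nonneg_right hcc₂ hw0'
        linarith only [this]
      exact mul_le_mul_of_nonneg_right (mul_le_mul h2 h3 (by positivity) (by norm_num)) (by positivity)
    exact mul_le_mul hsqW2 e (Real.sqrt_nonneg _) (by positivity)
  -- collect: `√Φ ≤ P2² 2^{19} (2^{-cρ} + 2^{3ρ+13} 2^{-ci} + 2^{3ρ+13} 2^{D'ρ} 2^{-cw})`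
  have hpow313 : (2 : ℝ) ^ (3 * (ρ : ℝ) + 13) * (2 : ℝ) ^ (-(7 * (ρ : ℝ)) / 2) ≤ 8192 * (2 : ℝ) ^ (-(c * ρ)) := by
    rw [← Real.rpow_add two_pos, show (8192 : ℝ) = (2 : ℝ) ^ (13 : ℝ) by norm_num, ← Real.rpow_add two_pos]
    refine Real.rpow_le_rpow_of_exponent_le one_le_two ?_
    linarith only [hcρ4, hρ0]
  set x : ℝ := (2 : ℝ) ^ (-(c * ρ)) with hx
  set Aρ : ℝ := (2 : ℝ) ^ (3 * (ρ : ℝ) + 13) with hAρ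
  set yi : ℝ := (2 : ℝ) ^ (-(c * i)) with hyi
  set yw : ℝ := (2 : ℝ) ^ (-(c * w)) with hyw
  set Dr : ℝ := (2 : ℝ) ^ ((D' : ℝ) * ρ) with hDr
  have hx0 : 0 ≤ x := by positivity
  have hAρ0 : 0 ≤ Aρ := by positivity
  have hyi0 : 0 ≤ yi := by positivity
  have hyw0 : 0 ≤ yw := by positivity
  have hDr0 : 0 ≤ Dr := by positivity
  have hP20 : 0 ≤ P2 ^ 2 := by positivity
  have hP21' : (1 : ℝ) ≤ P2 ^ 2 := one_le_pow₀ hP2_1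
  have hP2sq : P2 ≤ P2 ^ 2 := by
    calc P2 = P2 * 1 := (mul_one _).symm
      _ ≤ P2 * P2 := mul_le_mul_of_nonneg_left hP2_1 (by linarith)
      _ = P2 ^ 2 := (sq P2).symm
  have hsqrtΦ' : Real.sqrt Φ ≤ P2 ^ 2 * 2 ^ 19 * (x + Aρ * yi + Aρ * Dr * yw) := by
    have g4 : 18 * P2 ^ 2 * Aρ * (2 : ℝ) ^ (-(7 * (ρ : ℝ)) / 2) ≤ 18 * P2 ^ 2 * (8192 * x) := by
      have := mul_le_mul_of_nonneg_left hpow313 (by positivity : (0 : ℝ) ≤ 18 * P2 ^ 2)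
      calc 18 * P2 ^ 2 * Aρ * (2 : ℝ) ^ (-(7 * (ρ : ℝ)) / 2) = 18 * P2 ^ 2 * (Aρ * (2 : ℝ) ^ (-(7 * (ρ : ℝ)) / 2)) := by ring
        _ ≤ 18 * P2 ^ 2 * (8192 * x) := this
    have a1 : 6 * x ≤ 6 * (P2 ^ 2 * x) := by
      have := mul_le_mul_of_nonneg_right hP21' hx0
      linarith only [this]
    have a2 : 32 * P2 * x ≤ 32 * (P2 ^ 2 * x) := by
      have := mul_le_mul_of_nonneg_right hP2sq hx0
      linarith only [this]
    have n1 : 0 ≤ P2 ^ 2 * x := by positivity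
    have n2 : 0 ≤ P2 ^ 2 * (Aρ * yi) := by positivity
    have n3 : 0 ≤ P2 ^ 2 * (Aρ * Dr * yw) := by positivity
    calc Real.sqrt Φ ≤ Real.sqrt t1 + Real.sqrt t2 + Real.sqrt t3 + Real.sqrt t4 + Real.sqrt t5 := hsqrtΦ
      _ ≤ 6 * x + 32 * P2 * x + 18 * P2 ^ 2 * Aρ * yi + 18 * P2 ^ 2 * Aρ * (2 : ℝ) ^ (-(7 * (ρ : ℝ)) / 2) +
            18 * P2 ^ 2 * Aρ * (2 * yw * Dr) := by
          linarith only [hT1, hT2, hT3, hT4, hT5]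
      _ ≤ 6 * (P2 ^ 2 * x) + 32 * (P2 ^ 2 * x) + 18 * (P2 ^ 2 * (Aρ * yi)) + 18 * 8192 * (P2 ^ 2 * x) +
            36 * (P2 ^ 2 * (Aρ * Dr * yw)) := by
          have e1 : 18 * P2 ^ 2 * Aρ * yi = 18 * (P2 ^ 2 * (Aρ * yi)) := by ring
          have e2 : 18 * P2 ^ 2 * Aρ * (2 * yw * Dr) = 36 * (P2 ^ 2 * (Aρ * Dr * yw)) := by ring
          have e3 : 18 * P2 ^ 2 * (8192 * x) = 18 * 8192 * (P2 ^ 2 * x) := by ring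
          linarith only [a1, a2, g4, e1, e2, e3]
      _ ≤ P2 ^ 2 * 2 ^ 19 * (x + Aρ * yi + Aρ * Dr * yw) := by
          have e4 : P2 ^ 2 * (2 : ℝ) ^ 19 * (x + Aρ * yi + Aρ * Dr * yw) =
              524288 * (P2 ^ 2 * x) + 524288 * (P2 ^ 2 * (Aρ * yi)) + 524288 * (P2 ^ 2 * (Aρ * Dr * yw)) := by
            norm_num; ring
          rw [e4]
          linarith only [n1, n2, n3]
  -- the polynomial: `P2² 2^{19} 2^{13} ≤ P2^C`
  have hpoly : P2 ^ 2 * 2 ^ 19 * (8192 : ℝ) ≤ P2 ^ C := by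
    have e1 : P2 ^ C = P2 ^ (2 : ℝ) * P2 ^ (C - 2) := by
      rw [← Real.rpow_add (by linarith)]; ring_nf
    have e2 : P2 ^ (2 : ℝ) = P2 ^ 2 := by rw [← Real.rpow_natCast]; norm_num
    rw [e1, e2, mul_assoc]
    refine mul_le_mul_of_nonneg_left ?_ (by positivity)
    calc (2 : ℝ) ^ 19 * 8192 = 2 ^ (32 : ℝ) := by norm_num
      _ ≤ 3 ^ (32 : ℝ) := Real.rpow_le_rpow (by norm_num) (by norm_num) (by norm_num)
      _ ≤ 3 ^ (C - 2) := Real.rpow_le_rpow_of_exponent_le (by norm_num) (by linarith)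
      _ ≤ P2 ^ (C - 2) := Real.rpow_le_rpow (by norm_num) hbase3 (by linarith)
  have hw_mono : yw ≤ (2 : ℝ) ^ (-(c * w₀)) := by
    refine Real.rpow_le_rpow_of_exponent_le one_le_two ?_
    have : w₀ ≤ w := by
      rw [hw, hw₀]
      refine Finset.card_le_card fun t ht => ?_
      simp only [Finset.mem_filter] at ht ⊢
      exact ⟨ht.1, ht.2.1, by omega⟩
    have : (w₀ : ℝ) ≤ w := by exact_mod_cast this
    have := mul_le_mul_of_nonneg_left this hc0.le
    linarith only [this]
  -- final
  have hρ1 : (1 : ℝ) ≤ ρ := by exact_mod_cast hρ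
  have hC3ρ : 37 ≤ (C - 3 - D') * ρ := by
    have h1 : (37 : ℝ) ≤ C - 3 - D' := by rw [hC]; linarith
    calc (37 : ℝ) ≤ C - 3 - D' := h1
      _ ≤ (C - 3 - D') * ρ := le_mul_of_one_le_right (by linarith) hρ1
  have eCi : Aρ * yi ≤ (2 : ℝ) ^ (C * ρ - c * i) := by
    rw [hAρ, hyi, ← Real.rpow_add two_pos]
    refine Real.rpow_le_rpow_of_exponent_le one_le_two ?_
    nlinarith only [hC3ρ, hD'0, hρ0]
  have eCw : Aρ * Dr * yw ≤ (2 : ℝ) ^ (C * ρ - c * w₀) := by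
    calc Aρ * Dr * yw ≤ Aρ * Dr * (2 : ℝ) ^ (-(c * w₀)) := mul_le_mul_of_nonneg_left hw_mono (by positivity)
      _ = (2 : ℝ) ^ (3 * (ρ : ℝ) + 13 + (D' : ℝ) * ρ + -(c * w₀)) := by
          rw [hAρ, hDr, ← Real.rpow_add two_pos, ← Real.rpow_add two_pos]
      _ ≤ (2 : ℝ) ^ (C * ρ - c * w₀) := by
          refine Real.rpow_le_rpow_of_exponent_le one_le_two ?_
          nlinarith only [hC3ρ]
  have hfin : MN * Real.sqrt Φ ≤ P2 ^ C * 2 ^ (i + j) * (x + (2 : ℝ) ^ (C * ρ - c * i) + (2 : ℝ) ^ (C * ρ - c * w₀)) := by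
    rw [hMNeq, mul_comm (P2 ^ C), mul_assoc]
    refine mul_le_mul_of_nonneg_left ?_ (by positivity)
    calc Real.sqrt Φ ≤ P2 ^ 2 * 2 ^ 19 * (x + Aρ * yi + Aρ * Dr * yw) := hsqrtΦ'
      _ ≤ P2 ^ 2 * 2 ^ 19 * (8192 * (x + (2 : ℝ) ^ (C * ρ - c * i) + (2 : ℝ) ^ (C * ρ - c * w₀))) := by
          refine mul_le_mul_of_nonneg_left ?_ (by positivity)
          have h0 : 0 ≤ (2 : ℝ) ^ (C * ρ - c * i) := by positivity
          have h0' : 0 ≤ (2 : ℝ) ^ (C * ρ - c * w₀) := by positivity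
          linarith only [eCi, eCw, hx0, h0, h0']
      _ = (P2 ^ 2 * 2 ^ 19 * 8192) * (x + (2 : ℝ) ^ (C * ρ - c * i) + (2 : ℝ) ^ (C * ρ - c * w₀)) := by ring
      _ ≤ P2 ^ C * (x + (2 : ℝ) ^ (C * ρ - c * i) + (2 : ℝ) ^ (C * ρ - c * w₀)) :=
          mul_le_mul_of_nonneg_right hpoly (by positivity)
  rw [hP2] at hfin
  exact hSle.trans hfin

end Literature.NumberTheory.LFunctions.LiouvilleWalsh
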